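import Mathlib.MeasureTheory.Measure.Hausdorff
import Literature.Analysis.FluidPDE.ESSLocalHolderBlowupFarFieldBound
import Literature.Analysis.FluidPDE.ESSLocalHolderRepresentative
import Literature.Analysis.FluidPDE.PartialRegularityHolds
import Literature.Analysis.FluidPDE.SuitableWeakProofs
import Literature.Analysis.FluidPDE.BackwardUniquenessChainC12
import Literature.Analysis.FluidPDE.NSLocalLerayFarFieldRegularSlabProofs
import Literature.Analysis.FluidPDE.ESSLocalHolderVorticityC12
import Literature.Analysis.FluidPDE.ESSLocalHolderTopVanishingUniform
import Literature.Analysis.FluidPDE.ESSLocalHolderCovering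
import Literature.Analysis.FluidPDE.ESSLocalHolderBlowupLimit
import Literature.Analysis.FluidPDE.ESSLocalHolderConcentration
import Literature.Analysis.FluidPDE.CurlFreeLiouville
import Literature.Analysis.FluidPDE.HarmonicLiouvilleLp
import Literature.Analysis.FluidPDE.NSSuitableESSEpsilonHolds
import Literature.Analysis.FluidPDE.SuitableWeakCongr
import HarnessLib

/-!
# ESS 2003, Thm. 1.4 — no concentration: the blow-up/backward-uniqueness half of the proof

Escauriaza–Seregin–Šverák, *`L_{3,∞}`-solutions of Navier–Stokes equations and backward
uniqueness*, Russ. Math. Surveys **58** (2003), Thm. 1.4, §3, (3.21)–(3.32) and the concluding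
argument; in the form of Seregin's lecture notes (2014), §6.6 (Prop. 6.20, Thm. 6.21,
(6.6.7)–(6.6.13)) and Ch. 7 p. 139, and of Robinson–Rodrigo–Sadowski 2016, proof of Thm. 16.2,
Steps 3–5. This file closes the series `ESSLocalHolder*`: it proves, with theorems only (no new
named facts, D-0026),

  `ess_local_holder_of_higherRegularityBounds : NSBoundedHigherRegularityBounds → ess_local_holder`,

i.e. ESS Thm. 1.4 (`ess_local_holder`, `NSLerayHopfProofs.lean`) from the single pre-existing
named fact `NSBoundedHigherRegularityBounds` (quantitative higher interior regularity of bounded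
distributional solutions: Serrin 1962; ESS §3 (3.26)–(3.30); Seregin–Šverák 2009 §2), all other
inputs being proved in the tree: the covering reduction
`ess_local_holder_of_epsilonRegularity_of_noConcentration` (`ESSLocalHolderCovering`), the
ε-regularity `ess_epsilon_regularity'_holds` (ESS Lemma 2.2), the blow-up limit and its
properties (`ESSLocalHolderBlowup*`, `ESSLocalHolderConcentration`), the Caffarelli–Kohn–Nirenberg
theorem `ckn_partial_regularity_holds`, the class-`C¹₂` Carleman theory
(`Carleman.uniqueContinuation_uncurried_c12`, `Carleman.backwardUniqueness_uncurried_c12`;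
ESS Thms. 4.1 and 5.1 for fields `U ∈ C¹` with `∂ₓU ∈ C¹`, the class of the vorticity of the
blow-up limit), the vorticity calculus `vorticity_c12_of_isDistributionalNSSolutionOn`,
`vorticity_carleman_inequality`, `exists_uniform_small_near_top`, and the harmonic Liouville
theorem in `L³` (`eq_zero_of_harmonic_memLp_inner`).

## Part I — regular times and bounded strips (ESS §3, interior step; Seregin 2014, Ch. 7 p. 139)

* `volume_image_fst_eq_zero_of_isParabolicNull` — a `𝒫¹`-null set of space–time has a
  Lebesgue-null set of times (`𝒫¹`-null ⇒ `ℋ¹`-null; the time projection is `1`-Lipschitz;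
  `ℋ¹ = volume` on `ℝ`);
* `ae_forall_isRegularPoint` — for a suitable weak solution on `Q(a)`, a.e. `t ∈ ]-a², 0[` has
  only regular points `(t, x)`, `|x| < a` (CKN);
* `exists_strip_bound_of_forall_isRegularPoint`, `exists_strip_bound` — a regular slice carries
  a bounded strip `]t-τ, t+τ[ × ℝ³` (compactness + the far-field bound);
* `lintegral_pressure_slab_lt_top` — `π ∈ L^{3/2}(]-T, 0[ × ℝ³)`;
* `exists_representative_of_ae_bound` — smooth representative with bounded spatial derivatives
  up to order `4` on a region carrying an a.e. bound (`hB`).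

## Part II — the far-field vorticity vanishes (ESS §3, (3.31)–(3.32); Seregin 2014, Thm. 6.21)

* `Carleman.dt_const_smul_apply`, `…` — frame operators of constant multiples;
* `uniqueContinuation_input_c12` — ESS Thm. 4.1 in class `C¹₂` in the shape consumed by the
  half-space backward uniqueness theorem;
* `farField_curl_eq_zero` — for the far-field representative `U` (slices `C⁴`, bounded
  derivatives, `U = w` a.e., weak vanishing of `w` at the top time), `curl U = 0` on
  `]-1, 0[ × {|x| > R + 1}`: the time-reversed, normalised, translated vorticity satisfies every
  hypothesis of `Carleman.backwardUniqueness_uncurried_c12` on each half-space `{⟪y, e⟫ > 0}`.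

## Part III — no concentration (ESS §3, conclusion; RRS 2016, Thm. 16.2, Step 5)

* `blowup_farField_representative` — Part II applied to the blow-up limit;
* `strip_velocity_ae_zero` — **the interior step**: on a bounded strip the vorticity of the
  representative vanishes in the far field, hence identically at every time of the strip by
  unique continuation across the sphere (`Carleman.uniqueContinuation_uncurried_c12`), so the
  velocity slice is harmonic (`laplacian_eq_zero_of_curl_eq_zero_of_isDivFree`) and, being in
  `L³` for a.e. time, zero;
* `noConcentration_of_higherRegularityBounds` — no point of `Q̄(1/2)` is a point of
  `ε`-concentration (else the blow-up limit would be non-trivial, `blowup_lintegral_cube_ge`,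
  yet zero a.e. on `Q(1/2)` by the above at almost every — regular — time);
* `ess_local_holder_of_higherRegularityBounds` — ESS Thm. 1.4 from `NSBoundedHigherRegularityBounds`.

## References

* L. Escauriaza, G. Seregin, V. Šverák, *`L_{3,∞}`-solutions of Navier–Stokes equations and
  backward uniqueness*, Russ. Math. Surveys 58 (2003) 211–250, Thm. 1.4, §3, Thms. 4.1, 5.1.
  [EscauriazaSereginSverak2003]
* G. Seregin, *Lecture notes on regularity theory for the Navier–Stokes equations*, World
  Scientific (2014), §6.6 and Ch. 7 p. 139. [Seregin2014]
* J. C. Robinson, J. L. Rodrigo, W. Sadowski, *The three-dimensional Navier–Stokes equations*,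
  CUP (2016), Thm. 16.2 and its proof. [RobinsonRodrigoSadowski2016]
* L. Caffarelli, R. Kohn, L. Nirenberg, Comm. Pure Appl. Math. 35 (1982), Thm. B. [CKN1982]
-/

noncomputable section

open MeasureTheory TopologicalSpace Set Function Filter Metric
open _root_.Topology
open scoped ENNReal NNReal InnerProductSpace RealInnerProductSpace Laplacian

namespace Literature.Analysis.FluidPDE

/-! ## Part I. Regular times and bounded strips of the blow-up limit -/
/-! ### Parabolic-null sets have null time projection -/

section TimeProjection

/-- **A `𝒫¹`-null set of space–time has a Lebesgue-null set of times** (Robinson–Rodrigo–Sadowski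
2016, proof of Thm. 16.2, Step 5: "`𝒫¹(S) = 0` … almost every time is regular"): `𝒫¹`-null sets
are `ℋ¹`-null (`IsParabolicNull.hausdorffMeasure_eq_zero_holds`), the projection `(t, x) ↦ t`
is `1`-Lipschitz for the sup metric, and `ℋ¹ = volume` on `ℝ`. [cite: RobinsonRodrigoSadowski2016, proof of Thm. 16.2, Step 5 (PDF p. 251)] -/
theorem volume_image_fst_eq_zero_of_isParabolicNull {S : Set (ℝ × EuclideanSpace ℝ (Fin 3))}
    (hS : IsParabolicNull 1 S) : volume (Prod.fst '' S) = 0 := by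
  have h1 : μH[1] S = 0 := IsParabolicNull.hausdorffMeasure_eq_zero_holds one_pos hS
  have h2 : μH[1] (Prod.fst '' S) ≤ ((1 : ℝ≥0) : ℝ≥0∞) ^ (1 : ℝ) * μH[1] S :=
    LipschitzWith.prod_fst.hausdorffMeasure_image_le zero_le_one S
  rw [h1, mul_zero, nonpos_iff_eq_zero] at h2
  rw [← hausdorffMeasure_real]
  exact h2

end TimeProjection

/-! ### Almost every time of the blow-up limit is regular -/

section RegularTimes

variable {w : ℝ → EuclideanSpace ℝ (Fin 3) → EuclideanSpace ℝ (Fin 3)}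
  {π : ℝ → EuclideanSpace ℝ (Fin 3) → ℝ}

/-- **Almost every time is regular** (CKN 1982, Thm. B, through `ckn_partial_regularity_holds`;
ESS 2003, §3; Seregin 2014, Ch. 7 p. 139 "a set `Σ` of full measure"): for a suitable weak
solution on `Q(a)`, for a.e. `t ∈ ]-a², 0[` every point `(t, x)` with `|x| < a` is a regular
point. [cite: Seregin2014, Ch. 7 p. 139] [cite: CKN1982, Thm. B] -/
theorem ae_forall_isRegularPoint {a : ℝ}
    (hw : IsSuitableWeakSolutionOn
      (parabolicCylinderOpens a (0 : ℝ × EuclideanSpace ℝ (Fin 3))) 1 0 w π) :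
    ∀ᵐ t ∂(volume.restrict (Ioo (-a ^ 2) 0)),
      ∀ x ∈ ball (0 : EuclideanSpace ℝ (Fin 3)) a, IsRegularPoint w (t, x) := by
  have hnull : IsParabolicNull 1
      (singularSet w (parabolicCylinder a (0 : ℝ × EuclideanSpace ℝ (Fin 3)))) :=
    ckn_partial_regularity_holds (parabolicCylinderOpens a (0 : ℝ × EuclideanSpace ℝ (Fin 3)))
      one_pos hw (isCKNForceOn_zero _)
  have hN : volume (Prod.fst '' singularSet w
      (parabolicCylinder a (0 : ℝ × EuclideanSpace ℝ (Fin 3)))) = 0 :=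
    volume_image_fst_eq_zero_of_isParabolicNull hnull
  have hae : ∀ᵐ t ∂(volume : Measure ℝ),
      t ∉ Prod.fst '' singularSet w (parabolicCylinder a (0 : ℝ × EuclideanSpace ℝ (Fin 3))) :=
    measure_eq_zero_iff_ae_notMem.1 hN
  filter_upwards [ae_restrict_mem measurableSet_Ioo, ae_restrict_of_ae hae] with t ht htN x hx
  by_contra hreg
  refine htN ⟨(t, x), ⟨?_, hreg⟩, rfl⟩
  rw [mem_parabolicCylinder]
  simp only [Prod.fst_zero, Prod.snd_zero, zero_sub, dist_zero_right]
  exact ⟨⟨ht.1, ht.2⟩, mem_ball_zero_iff.1 hx⟩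

/-- **A regular slice carries a bounded strip** (compactness; ESS 2003, §3, interior step;
Seregin 2014, Ch. 7 p. 139): if every point of `{t} × B̄(0, R)` is a regular point of `w`, then
`|w| ≤ L` a.e. on `]t-τ, t+τ[ × B̄(0, R)` for some `τ > 0`, `L`. [cite: Seregin2014, Ch. 7 p. 139] -/
theorem exists_strip_bound_of_forall_isRegularPoint {t R : ℝ}
    (h : ∀ x ∈ closedBall (0 : EuclideanSpace ℝ (Fin 3)) R, IsRegularPoint w (t, x)) :
    ∃ τ : ℝ, 0 < τ ∧ ∃ L : ℝ,
      ∀ᵐ z ∂(volume.restrict (Ioo (t - τ) (t + τ) ×ˢ closedBall (0 : EuclideanSpace ℝ (Fin 3)) R)),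
        ‖w z.1 z.2‖ ≤ L := by
  classical
  choose! r hr hfin using h
  set K : Set (EuclideanSpace ℝ (Fin 3)) := closedBall (0 : EuclideanSpace ℝ (Fin 3)) R with hK
  have hKc : IsCompact K := isCompact_closedBall _ _
  obtain ⟨s, hsK⟩ := hKc.elim_finite_subcover (fun x : K => ball (x : EuclideanSpace ℝ (Fin 3)) (r x))
    (fun _ => isOpen_ball) (fun x hx => mem_iUnion.2 ⟨⟨x, hx⟩, mem_ball_self (hr x hx)⟩)
  rcases s.eq_empty_or_nonempty with hs | hs
  · -- empty cover: the ball is empty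
    refine ⟨1, one_pos, 0, ?_⟩
    have hKe : K = ∅ := by
      apply eq_empty_of_subset_empty
      intro x hx
      have hx' := hsK hx
      rw [hs] at hx'
      simp at hx'
    have : Ioo (t - 1) (t + 1) ×ˢ K = ∅ := by rw [hKe, prod_empty]
    rw [this, Measure.restrict_empty, ae_zero]
    exact eventually_bot
  · -- the strip parameters
    set τ : ℝ := s.inf' hs (fun x => r x ^ 2) with hτ
    have hτpos : 0 < τ := by
      rw [hτ, Finset.lt_inf'_iff]
      intro x _
      exact pow_pos (hr x x.2) 2
    set Lx : K → ℝ := fun x =>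
      (eLpNorm (uncurry w) ∞ (volume.restrict (parabolicCylinderCentered (r x) (t, (x : EuclideanSpace ℝ (Fin 3)))))).toReal
      with hLx
    set L : ℝ := s.sup' hs Lx with hL
    refine ⟨τ, hτpos, L, ?_⟩
    -- the strip is covered by the finitely many centred cylinders
    have hcover : Ioo (t - τ) (t + τ) ×ˢ K ⊆
        ⋃ x ∈ s, parabolicCylinderCentered (r x) (t, (x : EuclideanSpace ℝ (Fin 3))) := by
      rintro ⟨s', y⟩ ⟨hs', hy⟩
      obtain ⟨x, hx, hxy⟩ : ∃ x ∈ s, y ∈ ball (x : EuclideanSpace ℝ (Fin 3)) (r x) := by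
        simpa only [mem_iUnion, exists_prop] using hsK hy
      refine mem_iUnion₂.2 ⟨x, hx, ?_⟩
      have hτx : τ ≤ r x ^ 2 := Finset.inf'_le _ hx
      rw [mem_parabolicCylinderCentered]
      exact ⟨⟨by linarith [hs'.1], by linarith [hs'.2]⟩, mem_ball.1 hxy⟩
    refine ae_restrict_of_ae_restrict_of_subset hcover ?_
    rw [ae_restrict_biUnion_finset_iff]
    intro x hx
    have hLxL : Lx x ≤ L := Finset.le_sup' Lx hx
    have htop : eLpNorm (uncurry w) ∞
        (volume.restrict (parabolicCylinderCentered (r x) (t, (x : EuclideanSpace ℝ (Fin 3))))) < ∞ :=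
      hfin x x.2
    filter_upwards [enorm_ae_le_eLpNormEssSup (uncurry w)
      (volume.restrict (parabolicCylinderCentered (r x) (t, (x : EuclideanSpace ℝ (Fin 3)))))] with z hz
    rw [← eLpNorm_exponent_top] at hz
    have h1 : ‖w z.1 z.2‖ = (‖uncurry w z‖ₑ).toReal := by
      rw [← ofReal_norm, ENNReal.toReal_ofReal (norm_nonneg _)]; rfl
    rw [h1]
    exact (ENNReal.toReal_mono htop.ne hz).trans hLxL

/-- **A bounded strip around a regular time** (ESS 2003, §3, interior step; Seregin 2014, Ch. 7
p. 139): if `|w| ≤ 1` a.e. on the far field `]-T, 0[ × {|x| > R₀}` and every point of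
`{t} × B̄(0, R₀ + 1)` is regular, `-T < t < 0`, then `|w| ≤ L` a.e. on a full strip
`]t-τ, t+τ[ × ℝ³ ⊆ ]-T, 0[ × ℝ³`. [cite: Seregin2014, Ch. 7 p. 139] [cite: EscauriazaSereginSverak2003, §3 after (3.32)] -/
theorem exists_strip_bound {T R₀ t : ℝ}
    (hfar : ∀ᵐ z ∂(volume.restrict (Ioo (-T) 0 ×ˢ (closedBall (0 : EuclideanSpace ℝ (Fin 3)) R₀)ᶜ)),
      ‖w z.1 z.2‖ ≤ 1)
    (h : ∀ x ∈ closedBall (0 : EuclideanSpace ℝ (Fin 3)) (R₀ + 1), IsRegularPoint w (t, x))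
    (ht : t ∈ Ioo (-T) 0) :
    ∃ τ : ℝ, 0 < τ ∧ Ioo (t - τ) (t + τ) ⊆ Ioo (-T) 0 ∧ ∃ L : ℝ,
      ∀ᵐ z ∂(volume.restrict (Ioo (t - τ) (t + τ) ×ˢ (univ : Set (EuclideanSpace ℝ (Fin 3))))),
        ‖w z.1 z.2‖ ≤ L := by
  obtain ⟨τ₀, hτ₀, L₀, hL₀⟩ := exists_strip_bound_of_forall_isRegularPoint h
  set τ : ℝ := min τ₀ (min (t + T) (-t)) with hτ
  have hτpos : 0 < τ := lt_min hτ₀ (lt_min (by linarith [ht.1]) (by linarith [ht.2]))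
  have hτ₁ : τ ≤ τ₀ := min_le_left _ _
  have hτ₂ : τ ≤ t + T := (min_le_right _ _).trans (min_le_left _ _)
  have hτ₃ : τ ≤ -t := (min_le_right _ _).trans (min_le_right _ _)
  have hsubI : Ioo (t - τ) (t + τ) ⊆ Ioo (-T) 0 := Ioo_subset_Ioo (by linarith) (by linarith)
  refine ⟨τ, hτpos, hsubI, max L₀ 1, ?_⟩
  have hcover : Ioo (t - τ) (t + τ) ×ˢ (univ : Set (EuclideanSpace ℝ (Fin 3))) ⊆
      Ioo (t - τ₀) (t + τ₀) ×ˢ closedBall (0 : EuclideanSpace ℝ (Fin 3)) (R₀ + 1) ∪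
        Ioo (-T) 0 ×ˢ (closedBall (0 : EuclideanSpace ℝ (Fin 3)) R₀)ᶜ := by
    rintro ⟨s, y⟩ ⟨hs, -⟩
    by_cases hy : y ∈ closedBall (0 : EuclideanSpace ℝ (Fin 3)) (R₀ + 1)
    · exact Or.inl ⟨⟨by linarith [hs.1], by linarith [hs.2]⟩, hy⟩
    · refine Or.inr ⟨hsubI hs, ?_⟩
      rw [mem_compl_iff, mem_closedBall, dist_zero_right, not_le]
      rw [mem_closedBall, dist_zero_right, not_le] at hy
      linarith
  refine ae_restrict_of_ae_restrict_of_subset hcover ?_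
  rw [ae_restrict_union_iff]
  constructor
  · filter_upwards [hL₀] with z hz using hz.trans (le_max_left _ _)
  · filter_upwards [hfar] with z hz using hz.trans (le_max_right _ _)

end RegularTimes

/-! ### The pressure of the blow-up limit is in `L^{3/2}` of every slab -/

section Pressure

variable {w : ℝ → EuclideanSpace ℝ (Fin 3) → EuclideanSpace ℝ (Fin 3)}
  {π : ℝ → EuclideanSpace ℝ (Fin 3) → ℝ}

/-- **`π ∈ L^{3/2}(]-T, 0[ × ℝ³)`** for the blow-up limit (Seregin 2014, §6.6 (6.6.9):
`u ∈ L₃(]-T,0[ × ℝ³)`, `p ∈ L_{3/2}`; ESS 2003, §3 (3.21)–(3.22)): the scale bound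
`D(a; 0) ≤ D⋆` controls `∫_{Q(a)} |π|^{3/2} ≤ a² D⋆` on a cylinder containing
`]-T, 0[ × B̄(0, R)`, and the far field `]-T, 0[ × {|x| > R}` carries a small integral
(`exists_farField_small`). [cite: Seregin2014, §6.6 (6.6.9)] [cite: EscauriazaSereginSverak2003, §3 (3.21)–(3.22)] -/
theorem lintegral_pressure_slab_lt_top {M D : ℝ≥0}
    (hw : ∀ a : ℝ, 0 < a →
      IsSuitableWeakSolutionInBall a (0 : ℝ × EuclideanSpace ℝ (Fin 3)) w π)
    (hM : ∀ a : ℝ, 0 < a → ∀ᵐ s ∂(volume.restrict (Ioo (-a ^ 2) 0)),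
      ∫⁻ y in ball (0 : EuclideanSpace ℝ (Fin 3)) a, ‖w s y‖ₑ ^ (3 : ℕ) ≤ M)
    (hD : ∀ a : ℝ, 0 < a → cknD a (0 : ℝ × EuclideanSpace ℝ (Fin 3)) π ≤ D)
    {T : ℝ} (hT : 0 < T) :
    ∫⁻ z in Ioo (-T) 0 ×ˢ (univ : Set (EuclideanSpace ℝ (Fin 3))), ‖π z.1 z.2‖ₑ ^ (3 / 2 : ℝ) < ∞ := by
  obtain ⟨R, hR, hsmall⟩ := exists_farField_small hw hM hD hT (ε := 1) one_pos
  -- the near part lies in the cylinder `Q(a₁)`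
  set a₁ : ℝ := R + T + 1 with ha₁
  have ha₁pos : 0 < a₁ := by positivity
  have ha₁T : T ≤ a₁ ^ 2 := by nlinarith
  have hnear : Ioo (-T) 0 ×ˢ closedBall (0 : EuclideanSpace ℝ (Fin 3)) R ⊆
      parabolicCylinder a₁ (0 : ℝ × EuclideanSpace ℝ (Fin 3)) := by
    rintro ⟨s, y⟩ ⟨hs, hy⟩
    rw [mem_parabolicCylinder]
    simp only [Prod.fst_zero, Prod.snd_zero, zero_sub, dist_zero_right]
    rw [mem_closedBall, dist_zero_right] at hy
    exact ⟨⟨by linarith [hs.1], hs.2⟩, by linarith⟩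
  have hQ : ∫⁻ z in parabolicCylinder a₁ (0 : ℝ × EuclideanSpace ℝ (Fin 3)),
      ‖π z.1 z.2‖ₑ ^ (3 / 2 : ℝ) ≤ ENNReal.ofReal (a₁ ^ 2) * D := by
    have h1 := hD a₁ ha₁pos
    rw [cknD, Lemma142.inv_ofReal_sq ha₁pos] at h1
    have h2 : ENNReal.ofReal (a₁ ^ 2) * (ENNReal.ofReal ((a₁ ^ 2)⁻¹) *
        ∫⁻ z in parabolicCylinder a₁ (0 : ℝ × EuclideanSpace ℝ (Fin 3)), ‖π z.1 z.2‖ₑ ^ (3 / 2 : ℝ)) ≤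
        ENNReal.ofReal (a₁ ^ 2) * D := by gcongr
    rwa [← mul_assoc, ← ENNReal.ofReal_mul (by positivity),
      mul_inv_cancel₀ (by positivity), ENNReal.ofReal_one, one_mul] at h2
  have hsplit : Ioo (-T) 0 ×ˢ (univ : Set (EuclideanSpace ℝ (Fin 3))) ⊆
      Ioo (-T) 0 ×ˢ closedBall (0 : EuclideanSpace ℝ (Fin 3)) R ∪
        Ioo (-T) 0 ×ˢ (closedBall (0 : EuclideanSpace ℝ (Fin 3)) R)ᶜ := by
    rw [← prod_union, union_compl_self]
  calc ∫⁻ z in Ioo (-T) 0 ×ˢ (univ : Set (EuclideanSpace ℝ (Fin 3))), ‖π z.1 z.2‖ₑ ^ (3 / 2 : ℝ)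
      ≤ ∫⁻ z in Ioo (-T) 0 ×ˢ closedBall (0 : EuclideanSpace ℝ (Fin 3)) R ∪
          Ioo (-T) 0 ×ˢ (closedBall (0 : EuclideanSpace ℝ (Fin 3)) R)ᶜ, ‖π z.1 z.2‖ₑ ^ (3 / 2 : ℝ) :=
        lintegral_mono_set hsplit
    _ ≤ (∫⁻ z in Ioo (-T) 0 ×ˢ closedBall (0 : EuclideanSpace ℝ (Fin 3)) R, ‖π z.1 z.2‖ₑ ^ (3 / 2 : ℝ)) +
          ∫⁻ z in Ioo (-T) 0 ×ˢ (closedBall (0 : EuclideanSpace ℝ (Fin 3)) R)ᶜ, ‖π z.1 z.2‖ₑ ^ (3 / 2 : ℝ) :=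
        lintegral_union_le _ _ _
    _ ≤ ENNReal.ofReal (a₁ ^ 2) * D +
          ∫⁻ z in Ioo (-T) 0 ×ˢ (closedBall (0 : EuclideanSpace ℝ (Fin 3)) R)ᶜ,
            (‖w z.1 z.2‖ₑ ^ (3 : ℕ) + ‖π z.1 z.2‖ₑ ^ (3 / 2 : ℝ)) := by
        gcongr
        · exact (lintegral_mono_set hnear).trans hQ
        · exact le_add_self
    _ < ∞ := by
        refine ENNReal.add_lt_top.2 ⟨ENNReal.mul_lt_top ENNReal.ofReal_lt_top ENNReal.coe_lt_top, ?_⟩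
        exact hsmall.trans ENNReal.one_lt_top

end Pressure

/-! ### Smooth representatives on regions carrying an a.e. bound -/

section Representative

variable {w : ℝ → EuclideanSpace ℝ (Fin 3) → EuclideanSpace ℝ (Fin 3)}
  {π : ℝ → EuclideanSpace ℝ (Fin 3) → ℝ}

/-- **Smooth representative of the blow-up limit on a bounded-velocity region** (ESS 2003, §3,
(3.26)–(3.30): "the functions `u` and `p` are smooth … all derivatives are bounded"; the
regularity input is the quantitative Serrin theory `NSBoundedHigherRegularityBounds`, taken as
the hypothesis `hB`). Let `(w, π)` be a suitable weak solution in every cylinder `Q(a')`, with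
`π ∈ L^{3/2}(]-T, 0[ × ℝ³)`. Let `]a, b[ × S`, `S` open, `-T ≤ a - 4ρ²`, `b ≤ 0`, and suppose
`|w| ≤ L` a.e. on `]a - 4ρ², b[ × S'` where `S'` contains the `2ρ`-ball around every point of
`S`. Then `w` has a representative `U` on `]a, b[ × S`: jointly continuous, with `C^∞` slices,
all spatial derivatives jointly continuous, and `‖D_xⁿ U‖ ≤ K` for `n ≤ 4`
(`exists_smooth_representative_of_locally_bounded` on the cylinders `Q((min(t+ρ², b), x), 2ρ)`,
which lie in `]a - 4ρ², b[ × B(x, 2ρ)`). [cite: EscauriazaSereginSverak2003, §3 (3.26)–(3.30)] -/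
theorem exists_representative_of_ae_bound (hB : NSBoundedHigherRegularityBounds)
    (hw : ∀ a : ℝ, 0 < a →
      IsSuitableWeakSolutionInBall a (0 : ℝ × EuclideanSpace ℝ (Fin 3)) w π)
    {T : ℝ} (hπ : ∫⁻ z in Ioo (-T) 0 ×ˢ (univ : Set (EuclideanSpace ℝ (Fin 3))),
      ‖π z.1 z.2‖ₑ ^ (3 / 2 : ℝ) < ∞)
    {a b ρ L : ℝ} {S S' : Set (EuclideanSpace ℝ (Fin 3))} (hS : IsOpen S) (hρ : 0 < ρ)
    (haT : -T ≤ a - 4 * ρ ^ 2) (hb : b ≤ 0)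
    (hSS' : ∀ x ∈ S, ball x (2 * ρ) ⊆ S')
    (hbd : ∀ᵐ z ∂(volume.restrict (Ioo (a - 4 * ρ ^ 2) b ×ˢ S')), ‖w z.1 z.2‖ ≤ L) :
    ∃ (K : ℝ) (U : ℝ → EuclideanSpace ℝ (Fin 3) → EuclideanSpace ℝ (Fin 3)),
      uncurry U =ᵐ[volume.restrict (Ioo a b ×ˢ S)] uncurry w ∧
      ContinuousOn (uncurry U) (Ioo a b ×ˢ S) ∧
      (∀ z ∈ Ioo a b ×ˢ S, ContDiffAt ℝ (⊤ : ℕ∞) (U z.1) z.2) ∧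
      (∀ n : ℕ, ContinuousOn
        (fun z : ℝ × EuclideanSpace ℝ (Fin 3) => iteratedFDeriv ℝ n (U z.1) z.2) (Ioo a b ×ˢ S)) ∧
      ∀ n ≤ 4, ∀ z ∈ Ioo a b ×ˢ S, ‖iteratedFDeriv ℝ n (U z.1) z.2‖ ≤ K := by
  -- the distributional formulation on every open region below `t = 0`
  have hdist : ∀ a' : ℝ, 0 < a' → IsDistributionalNSSolutionOn
      (parabolicCylinderOpens a' (0 : ℝ × EuclideanSpace ℝ (Fin 3))) 1 0 w π :=
    fun a' ha' => (hw a' ha').1.distributional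
  -- the uniform pressure bound
  set P : ℝ≥0 := (∫⁻ z in Ioo (-T) 0 ×ˢ (univ : Set (EuclideanSpace ℝ (Fin 3))),
      ‖π z.1 z.2‖ₑ ^ (3 / 2 : ℝ)).toNNReal with hP
  have hPeq : ((P : ℝ≥0) : ℝ≥0∞) = ∫⁻ z in Ioo (-T) 0 ×ˢ (univ : Set (EuclideanSpace ℝ (Fin 3))),
      ‖π z.1 z.2‖ₑ ^ (3 / 2 : ℝ) := ENNReal.coe_toNNReal hπ.ne
  -- the cylinders around the points of the region
  have hcyl : ∀ z ∈ Ioo a b ×ˢ S,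
      parabolicCylinder (2 * ρ) (min (z.1 + ρ ^ 2) b, z.2) ⊆ Ioo (a - 4 * ρ ^ 2) b ×ˢ ball z.2 (2 * ρ) := by
    rintro ⟨t, x⟩ ⟨ht, -⟩ ⟨s, y⟩ hq
    rw [mem_parabolicCylinder] at hq
    obtain ⟨⟨hs1, hs2⟩, hy⟩ := hq
    simp only at hs1 hs2 hy
    refine ⟨⟨?_, lt_of_lt_of_le hs2 (min_le_right _ _)⟩, mem_ball.2 hy⟩
    have h1 : a < min (t + ρ ^ 2) b := lt_min (by linarith [ht.1, sq_nonneg ρ]) (ht.1.trans ht.2)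
    nlinarith
  refine exists_smooth_representative_of_locally_bounded hB (w := w) (π := π) hS (M := L) (P := P)
    hρ (fun z hz => ⟨?_, ?_, ?_⟩) 4
  · -- distributional solution in the cylinder
    refine isDistributionalNSSolutionOn_of_forall_cylinder hdist (isOpen_parabolicCylinder _ _) ?_
    intro q hq
    have hq' := hcyl z hz hq
    exact ⟨lt_of_lt_of_le hq'.1.2 hb, mem_univ _⟩
  · -- the velocity bound
    refine ae_restrict_of_ae_restrict_of_subset ((hcyl z hz).trans ?_) hbd
    exact prod_mono Subset.rfl (hSS' z.2 hz.2)
  · -- the pressure bound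
    rw [hPeq]
    refine lintegral_mono_set ((hcyl z hz).trans ?_)
    exact prod_mono (Ioo_subset_Ioo haT hb) (subset_univ _)

end Representative

/-! ## Part II. The far-field vorticity of the blow-up limit vanishes -/
/-! ### Frame operators and constant multiples -/

namespace Carleman

section ConstSMul

variable {E : Type*} [NormedAddCommGroup E] [InnerProductSpace ℝ E] [FiniteDimensional ℝ E]
variable {F : Type*} [NormedAddCommGroup F] [InnerProductSpace ℝ F]

omit [FiniteDimensional ℝ E] in
/-- `∂ₜ(c u) = c ∂ₜu` (unconditionally: scalar multiplication by a field element). [folklore] -/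
theorem dt_const_smul_apply (c : ℝ) (u : ℝ × E → F) (z : ℝ × E) :
    dt (fun y => c • u y) z = c • dt u z := by
  rw [dt_apply, dt_apply, show (fun y => c • u y) = c • u from rfl, fderiv_const_smul_field]
  rfl

omit [FiniteDimensional ℝ E] in
/-- `∂ₑ(c u) = c ∂ₑu` as functions. [folklore] -/
theorem dx_const_smul_eq (c : ℝ) (u : ℝ × E → F) (e : E) :
    dx e (fun y => c • u y) = fun z => c • dx e u z := by
  funext z
  rw [dx_apply, dx_apply, show (fun y => c • u y) = c • u from rfl, fderiv_const_smul_field]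
  rfl

/-- `Δ(c u) = c Δu`. [folklore] -/
theorem lap_const_smul_apply (c : ℝ) (u : ℝ × E → F) (z : ℝ × E) :
    lap (fun y => c • u y) z = c • lap u z := by
  simp only [lap, dx_const_smul_eq, Finset.smul_sum]

/-- `|∇(c u)|² = c² |∇u|²`. [folklore] -/
theorem gradSq_const_smul_apply (c : ℝ) (u : ℝ × E → F) (z : ℝ × E) :
    gradSq (fun y => c • u y) z = c ^ 2 * gradSq u z := by
  simp only [gradSq, dx_const_smul_eq, norm_smul, Real.norm_eq_abs, mul_pow, sq_abs,
    Finset.mul_sum]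

end ConstSMul

end Carleman

section FarField


/-- The unique-continuation input of `Carleman.backwardUniqueness_uncurried_c12` on `ℝ³`, in
the class `C¹ ∩ {∂ₓu ∈ C¹}`, is the theorem `Carleman.uniqueContinuation_uncurried_c12`. [folklore] -/
theorem uniqueContinuation_input_c12 :
    ∀ (c R T : ℝ), 0 ≤ c → 0 < R → 0 < T → ∀ U : ℝ × (EuclideanSpace ℝ (Fin 3)) → (EuclideanSpace ℝ (Fin 3)),
      ContDiffOn ℝ 1 U (Ioo (0 : ℝ) T ×ˢ ball (0 : (EuclideanSpace ℝ (Fin 3))) R) →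
      (∀ e' : (EuclideanSpace ℝ (Fin 3)), ContDiffOn ℝ 1 (Carleman.dx e' U) (Ioo (0 : ℝ) T ×ˢ ball (0 : (EuclideanSpace ℝ (Fin 3))) R)) →
      ContinuousOn U (Ico (0 : ℝ) T ×ˢ ball (0 : (EuclideanSpace ℝ (Fin 3))) R) →
      (∀ z ∈ Ioo (0 : ℝ) T ×ˢ ball (0 : (EuclideanSpace ℝ (Fin 3))) R,
        ‖Carleman.dt U z + Carleman.lap U z‖ ≤ c * (‖U z‖ + Real.sqrt (Carleman.gradSq U z))) →
      (∀ k : ℕ, ∃ C : ℝ, ∀ z ∈ Ioo (0 : ℝ) T ×ˢ ball (0 : (EuclideanSpace ℝ (Fin 3))) R,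
        ‖U z‖ ≤ C * (‖z.2‖ + Real.sqrt z.1) ^ k) →
      ∀ x ∈ ball (0 : (EuclideanSpace ℝ (Fin 3))) R, U (0, x) = 0 :=
  fun _ _ _ hc hR hT _ hU hUx hUc hineq hvan =>
    Carleman.uniqueContinuation_uncurried_c12 3 3 hc hR hT hU hUx hUc hineq hvan

/-- Membership in the open half-space beyond a given one: if `⟪y, e⟫ > 0` then
`x₀ + y`, `x₀ = (R + 1) e` (`‖e‖ = 1`), has norm `> R + 1`. [folklore] -/
theorem norm_gt_of_inner_pos {e : (EuclideanSpace ℝ (Fin 3))} (he : ‖e‖ = 1) (R : ℝ) {y : (EuclideanSpace ℝ (Fin 3))}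
    (hy : 0 < ⟪y, e⟫) : R + 1 < ‖(R + 1) • e + y‖ := by
  have h1 : ⟪(R + 1) • e + y, e⟫ = (R + 1) + ⟪y, e⟫ := by
    rw [inner_add_left, real_inner_smul_left, real_inner_self_eq_norm_sq, he]; ring
  have h2 : ⟪(R + 1) • e + y, e⟫ ≤ ‖(R + 1) • e + y‖ := by
    have h := real_inner_le_norm ((R + 1) • e + y) e
    rwa [he, mul_one] at h
  linarith

set_option maxHeartbeats 1600000 in
/-- **The far-field vorticity of the blow-up limit vanishes** (Escauriaza–Seregin–Šverák 2003,
§3, (3.31)–(3.32): "`ω = 0` on `(ℝ³ ∖ B̄(R)) × ]-T₂, 0[`" by backward uniqueness in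
half-spaces, Thm. 5.1). Setting: `U` is the smooth-in-space representative of the blow-up
limit `w` on the far field `Ω = ]-1, 0[ × {|x| > R}` — a distributional solution `(U, π)` of
the Navier–Stokes system there with `C⁴` slices, jointly continuous spatial derivatives
`D_xⁿU`, `n ≤ 4`, and `‖D_xⁿU‖ ≤ K` — and the slices of `w` tend weakly to zero at the top time
(`blowup_top_vanishing`). Then `curl U(t, ·) = 0` at every point of `]-1, 0[ × {|x| > R + 1}`.
Proof: the vorticity `ω = curl U` is of the class `C¹ ∩ {∂ₓω ∈ C¹}` and satisfies
`|∂ₜω - Δω| ≤ 2K(|ω| + |∇ω|)` (`vorticity_carleman_inequality`), is bounded, and tends to zero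
at the top uniformly near every far point (`exists_uniform_small_near_top`); for a unit vector
`e`, the time-reversed, normalised, translated field `u(s, y) = c₀ ω(-s, (R+1)e + y)` extended
by `0` at `s = 0` satisfies every hypothesis of the half-space backward uniqueness theorem in
that class (`Carleman.backwardUniqueness_uncurried_c12`, with
`Carleman.uniqueContinuation_uncurried_c12` as its unique-continuation input), hence vanishes
on `]0, 1[ × {⟪y, e⟫ > 0}`; the union over `e` covers `{|x| > R + 1}`.
[cite: EscauriazaSereginSverak2003, §3 (3.31)-(3.32) and Thm. 5.1] -/
theorem farField_curl_eq_zero {w U : ℝ → (EuclideanSpace ℝ (Fin 3)) → (EuclideanSpace ℝ (Fin 3))} {π : ℝ → (EuclideanSpace ℝ (Fin 3)) → ℝ} {R K : ℝ} (hR : 0 ≤ R)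
    (htop : ∀ φ : (EuclideanSpace ℝ (Fin 3)) → (EuclideanSpace ℝ (Fin 3)), ContDiff ℝ (⊤ : ℕ∞) φ → HasCompactSupport φ → ∀ ε : ℝ, 0 < ε →
      ∃ s₀ : ℝ, s₀ < 0 ∧ ∀ᵐ s ∂(volume.restrict (Ioo s₀ 0)), |∫ y, ⟪w s y, φ y⟫| ≤ ε)
    (hae : uncurry U =ᵐ[volume.restrict (Ioo (-1 : ℝ) 0 ×ˢ (closedBall (0 : (EuclideanSpace ℝ (Fin 3))) R)ᶜ)] uncurry w)
    (hsol : IsDistributionalNSSolutionOn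
      ⟨Ioo (-1 : ℝ) 0 ×ˢ (closedBall (0 : (EuclideanSpace ℝ (Fin 3))) R)ᶜ, isOpen_Ioo.prod isClosed_closedBall.isOpen_compl⟩
      1 0 U π)
    (hU4 : ∀ t ∈ Ioo (-1 : ℝ) 0, ContDiffOn ℝ 4 (U t) (closedBall (0 : (EuclideanSpace ℝ (Fin 3))) R)ᶜ)
    (hΦ : ∀ n ≤ 4, ContinuousOn (fun z : ℝ × (EuclideanSpace ℝ (Fin 3)) => iteratedFDeriv ℝ n (U z.1) z.2)
      (Ioo (-1 : ℝ) 0 ×ˢ (closedBall (0 : (EuclideanSpace ℝ (Fin 3))) R)ᶜ))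
    (hK : ∀ n ≤ 3, ∀ z ∈ Ioo (-1 : ℝ) 0 ×ˢ (closedBall (0 : (EuclideanSpace ℝ (Fin 3))) R)ᶜ,
      ‖iteratedFDeriv ℝ n (U z.1) z.2‖ ≤ K) :
    ∀ z ∈ Ioo (-1 : ℝ) 0 ×ˢ {x : (EuclideanSpace ℝ (Fin 3)) | R + 1 < ‖x‖}, curl (U z.1) z.2 = 0 := by
  -- ### notation and basic facts
  set I : Set ℝ := Ioo (-1 : ℝ) 0 with hI
  set S : Set (EuclideanSpace ℝ (Fin 3)) := (closedBall (0 : (EuclideanSpace ℝ (Fin 3))) R)ᶜ with hSdef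
  have hIo : IsOpen I := isOpen_Ioo
  have hSo : IsOpen S := isClosed_closedBall.isOpen_compl
  set O : Set (ℝ × (EuclideanSpace ℝ (Fin 3))) := I ×ˢ S with hOdef
  have hOo : IsOpen O := hIo.prod hSo
  have hK0 : 0 ≤ K := by
    have hz : ((-(1 : ℝ) / 2, (R + 1) • EuclideanSpace.basisFun (Fin 3) ℝ 0) : ℝ × (EuclideanSpace ℝ (Fin 3))) ∈ O := by
      refine ⟨⟨by norm_num, by norm_num⟩, ?_⟩
      show (R + 1) • EuclideanSpace.basisFun (Fin 3) ℝ 0 ∈ (closedBall (0 : (EuclideanSpace ℝ (Fin 3))) R)ᶜ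
      rw [mem_compl_iff, mem_closedBall, dist_zero_right, norm_smul, Real.norm_eq_abs,
        (EuclideanSpace.basisFun (Fin 3) ℝ).orthonormal.1 0, mul_one, abs_of_pos (by linarith)]
      linarith
    exact (norm_nonneg _).trans (hK 0 (by norm_num) _ hz)
  -- bounds on `U` and `D U` in the usual form
  have hK₀ : ∀ z ∈ O, ‖U z.1 z.2‖ ≤ K := fun z hz => by
    have h := hK 0 (by norm_num) z hz
    rwa [norm_iteratedFDeriv_zero] at h
  have hK₁ : ∀ z ∈ O, ‖fderiv ℝ (U z.1) z.2‖ ≤ K := fun z hz => by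
    have h := hK 1 (by norm_num) z hz
    rwa [norm_iteratedFDeriv_one] at h
  -- ### the vorticity: class, equation, bounds
  obtain ⟨-, hU0, hderiv, hω1, hωx⟩ :=
    vorticity_c12_of_isDistributionalNSSolutionOn hIo hSo hsol hU4 hΦ
  obtain ⟨hdt, -, hineq⟩ := vorticity_carleman_inequality hIo hSo hsol hU4 hΦ hK₀ hK₁
  have hκ0 : 0 ≤ ‖curlCLM‖ := ContinuousLinearMap.opNorm_nonneg _
  -- pointwise bounds: `|ω| ≤ ‖curlCLM‖K`, `|∂ₜω| ≤ (3 * 1 * ‖curlCLM‖ * K + 2 * ‖curlCLM‖ * K ^ 2)`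
  have hbounds : ∀ z ∈ O, ‖(uncurry (vorticity U)) z‖ ≤ ‖curlCLM‖ * K ∧ ‖Carleman.dt (uncurry (vorticity U)) z‖ ≤ (3 * 1 * ‖curlCLM‖ * K + 2 * ‖curlCLM‖ * K ^ 2) := by
    intro z hz
    have hU3 : ContDiffOn ℝ 3 (U z.1) S := (hU4 z.1 hz.1).of_le (by norm_cast)
    obtain ⟨b0, -, -, b3⟩ := vorticity_pointwise_bounds hSo hU3 hz.2 hK0 zero_le_one
      (hK₀ z hz) (hK₁ z hz) (hK 2 (by norm_num) z hz) (hK 3 le_rfl z hz)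
    refine ⟨?_, ?_⟩
    · show ‖vorticity U z.1 z.2‖ ≤ _
      simpa [vorticity_apply] using b0
    · rw [hdt z hz]
      simpa [vorticity_apply] using b3
  -- ### uniform smallness at the top
  have hU2 : ∀ z ∈ O, ContDiffAt ℝ 2 (U z.1) z.2 := fun z hz =>
    ((hU4 z.1 hz.1).of_le (by norm_cast)).contDiffAt (hSo.mem_nhds hz.2)
  have hK₂ : ∀ z ∈ O, ‖iteratedFDeriv ℝ 2 (U z.1) z.2‖ ≤ K := fun z hz => hK 2 (by norm_num) z hz
  have hsmall := fun (x₀ : (EuclideanSpace ℝ (Fin 3))) (hx₀ : x₀ ∈ S) (θ : ℝ) (hθ : 0 < θ) =>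
    exists_uniform_small_near_top (w := w) (U := U) (a := -1) (by norm_num) hSo htop hae hU0 hU2
      hK₁ hK₂ hx₀ hθ
  -- ### reduction to half-spaces through `x₀ = (R + 1) e`
  suffices hhalf : ∀ e : (EuclideanSpace ℝ (Fin 3)), ‖e‖ = 1 → ∀ t ∈ I, ∀ x : (EuclideanSpace ℝ (Fin 3)), R + 1 < ⟪x, e⟫ → curl (U t) x = 0 by
    rintro ⟨t, x⟩ ⟨ht, hx⟩
    have hx' : R + 1 < ‖x‖ := hx
    have hxn : 0 < ‖x‖ := by linarith
    have hx0 : x ≠ 0 := norm_pos_iff.1 hxn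
    set e : (EuclideanSpace ℝ (Fin 3)) := ‖x‖⁻¹ • x with hedef
    have he : ‖e‖ = 1 := norm_smul_inv_norm hx0
    have hxe : ⟪x, e⟫ = ‖x‖ := by
      rw [hedef, real_inner_smul_right, real_inner_self_eq_norm_sq]
      field_simp
    exact hhalf e he t ht x (by rw [hxe]; exact hx')
  intro e he
  set x₀ : (EuclideanSpace ℝ (Fin 3)) := (R + 1) • e with hx₀def
  set H : Set (EuclideanSpace ℝ (Fin 3)) := {y : (EuclideanSpace ℝ (Fin 3)) | 0 < ⟪y, e⟫} with hHdef
  have hHo : IsOpen H := isOpen_lt continuous_const (continuous_id.inner continuous_const)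
  set Q : Set (ℝ × (EuclideanSpace ℝ (Fin 3))) := Ioo (0 : ℝ) 1 ×ˢ H with hQdef
  have hQo : IsOpen Q := isOpen_Ioo.prod hHo
  -- the affine change of variables `A(s, y) = (-s, x₀ + y)`
  set A : ℝ × (EuclideanSpace ℝ (Fin 3)) → ℝ × (EuclideanSpace ℝ (Fin 3)) := stAffine (-1) 1 0 x₀ with hAdef
  have hA : ∀ z : ℝ × (EuclideanSpace ℝ (Fin 3)), A z = (-z.1, x₀ + z.2) := fun z => by
    simp [hAdef, stAffine]
  have hx₀S : ∀ y ∈ H, x₀ + y ∈ S := by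
    intro y hy
    show x₀ + y ∈ (closedBall (0 : (EuclideanSpace ℝ (Fin 3))) R)ᶜ
    rw [mem_compl_iff, mem_closedBall, dist_zero_right, not_le, hx₀def]
    linarith [norm_gt_of_inner_pos he R hy]
  have hAO : ∀ z ∈ Q, A z ∈ O := by
    rintro ⟨s', y⟩ ⟨hs', hy⟩
    rw [hA]
    exact ⟨⟨by linarith [hs'.2], by linarith [hs'.1]⟩, hx₀S y hy⟩
  have hpre : Q ⊆ A ⁻¹' O := fun z hz => hAO z hz
  -- the normalised, time-reversed vorticity
  set c₀ : ℝ := (‖curlCLM‖ * K + 1)⁻¹ with hc₀def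
  have hc₀ : 0 < c₀ := by positivity
  have hc₀1 : c₀ * (‖curlCLM‖ * K) ≤ 1 := by
    rw [hc₀def, inv_mul_le_iff₀ (by positivity)]
    linarith
  set ut : ℝ × (EuclideanSpace ℝ (Fin 3)) → (EuclideanSpace ℝ (Fin 3)) := fun z => c₀ • (uncurry (vorticity U)) (A z) with hutdef
  set u : ℝ × (EuclideanSpace ℝ (Fin 3)) → (EuclideanSpace ℝ (Fin 3)) := fun z => if 0 < z.1 then ut z else 0 with hudef
  have huQ : ∀ z ∈ Q, u z = ut z := fun z hz => if_pos hz.1.1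
  -- ### regularity of `ut` and `u` on `Q`
  have hut1 : ContDiffOn ℝ 1 ut Q :=
    ((Carleman.contDiffOn_comp_stAffine hω1 (-1) 1 0 x₀).const_smul c₀).mono hpre
  have hdxut : ∀ e' : (EuclideanSpace ℝ (Fin 3)), Carleman.dx e' ut = fun z => c₀ • Carleman.dx e' (uncurry (vorticity U)) (A z) := by
    intro e'
    rw [hutdef, Carleman.dx_const_smul_eq]
    funext z
    rw [Carleman.dx_comp_stAffine (by norm_num) one_ne_zero (uncurry (vorticity U)) e' z, one_smul]
  have hutx : ∀ e' : (EuclideanSpace ℝ (Fin 3)), ContDiffOn ℝ 1 (Carleman.dx e' ut) Q := by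
    intro e'
    rw [hdxut e']
    exact ((Carleman.contDiffOn_comp_stAffine (hωx e') (-1) 1 0 x₀).const_smul c₀).mono hpre
  have hframe : ∀ z ∈ Q, Carleman.dt u z = Carleman.dt ut z ∧
      (∀ e', Carleman.dx e' u z = Carleman.dx e' ut z) ∧
      (∀ e', Carleman.dx e' (Carleman.dx e' u) z = Carleman.dx e' (Carleman.dx e' ut) z) ∧
      Carleman.lap u z = Carleman.lap ut z ∧ Carleman.gradSq u z = Carleman.gradSq ut z :=
    fun z hz => Carleman.frame_eq_of_eventuallyEq hQo hz huQ
  have hu1 : ContDiffOn ℝ 1 u Q := hut1.congr huQ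
  have hux : ∀ e' : (EuclideanSpace ℝ (Fin 3)), ContDiffOn ℝ 1 (Carleman.dx e' u) Q := fun e' =>
    (hutx e').congr fun z hz => (hframe z hz).2.1 e'
  -- frame operators of `ut` in terms of those of `(uncurry (vorticity U))`
  have hdtut : ∀ z, Carleman.dt ut z = c₀ • ((-1 : ℝ) • Carleman.dt (uncurry (vorticity U)) (A z)) := fun z => by
    rw [hutdef, Carleman.dt_const_smul_apply, Carleman.dt_comp_stAffine (by norm_num) one_ne_zero]
  have hlaput : ∀ z, Carleman.lap ut z = c₀ • Carleman.lap (uncurry (vorticity U)) (A z) := fun z => by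
    rw [hutdef, Carleman.lap_const_smul_apply, Carleman.lap_comp_stAffine (by norm_num) one_ne_zero,
      one_pow, one_smul]
  have hgradut : ∀ z, Carleman.gradSq ut z = c₀ ^ 2 * Carleman.gradSq (uncurry (vorticity U)) (A z) := fun z => by
    rw [hutdef, Carleman.gradSq_const_smul_apply, Carleman.gradSq_comp_stAffine (by norm_num) one_ne_zero,
      one_pow, one_mul]
  have hnormut : ∀ z, ‖ut z‖ = c₀ * ‖(uncurry (vorticity U)) (A z)‖ := fun z => by
    rw [hutdef, norm_smul, Real.norm_eq_abs, abs_of_pos hc₀]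
  have hsqrtut : ∀ z, Real.sqrt (Carleman.gradSq ut z) = c₀ * Real.sqrt (Carleman.gradSq (uncurry (vorticity U)) (A z)) :=
    fun z => by rw [hgradut, Real.sqrt_mul (sq_nonneg _), Real.sqrt_sq hc₀.le]
  -- ### (hBH) the differential inequality
  have hBH : ∀ z ∈ Q, ‖Carleman.dt u z + Carleman.lap u z‖ ≤
      (2 * K) * (‖u z‖ + Real.sqrt (Carleman.gradSq u z)) := by
    intro z hz
    obtain ⟨h1, -, -, h4, h5⟩ := hframe z hz
    rw [h1, h4, h5, huQ z hz, hdtut, hlaput, hnormut, hsqrtut]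
    have e1 : c₀ • ((-1 : ℝ) • Carleman.dt (uncurry (vorticity U)) (A z)) + c₀ • Carleman.lap (uncurry (vorticity U)) (A z) =
        -(c₀ • (Carleman.dt (uncurry (vorticity U)) (A z) - Carleman.lap (uncurry (vorticity U)) (A z))) := by
      simp only [smul_sub, neg_one_smul, smul_neg]
      abel
    rw [e1, norm_neg, norm_smul, Real.norm_eq_abs, abs_of_pos hc₀]
    have h := hineq (A z) (hAO z hz)
    calc c₀ * ‖Carleman.dt (uncurry (vorticity U)) (A z) - Carleman.lap (uncurry (vorticity U)) (A z)‖
        ≤ c₀ * ((K + K) * (‖(uncurry (vorticity U)) (A z)‖ + Real.sqrt (Carleman.gradSq (uncurry (vorticity U)) (A z)))) :=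
          mul_le_mul_of_nonneg_left h hc₀.le
      _ = (2 * K) * (c₀ * ‖(uncurry (vorticity U)) (A z)‖ + c₀ * Real.sqrt (Carleman.gradSq (uncurry (vorticity U)) (A z))) := by ring
  -- ### (hgrowth), (h0)
  have hgrowth : ∀ z ∈ Q, ‖u z‖ ≤ Real.exp (0 * ‖z.2‖ ^ 2) := by
    intro z hz
    rw [zero_mul, Real.exp_zero, huQ z hz, hnormut]
    calc c₀ * ‖(uncurry (vorticity U)) (A z)‖ ≤ c₀ * (‖curlCLM‖ * K) := mul_le_mul_of_nonneg_left (hbounds _ (hAO z hz)).1 hc₀.le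
      _ ≤ 1 := hc₀1
  have h0 : ∀ y : (EuclideanSpace ℝ (Fin 3)), 0 < ⟪y, e⟫ → u (0, y) = 0 := fun y _ => if_neg (lt_irrefl 0)
  -- ### (hH3) square integrability of `∂ₜu` on bounded sets
  have hH3 : ∀ K' ⊆ Q, Bornology.IsBounded K' → MeasurableSet K' →
      ∫⁻ z in K', ‖Carleman.dt u z‖ₑ ^ 2 < ∞ := by
    intro K' hK' hK'b hK'm
    have hbd : ∀ z ∈ K', ‖Carleman.dt u z‖ₑ ^ 2 ≤ ENNReal.ofReal ((c₀ * (3 * 1 * ‖curlCLM‖ * K + 2 * ‖curlCLM‖ * K ^ 2)) ^ 2) := by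
      intro z hz
      have hzQ := hK' hz
      rw [(hframe z hzQ).1, hdtut]
      have hn : ‖c₀ • ((-1 : ℝ) • Carleman.dt (uncurry (vorticity U)) (A z))‖ ≤ c₀ * (3 * 1 * ‖curlCLM‖ * K + 2 * ‖curlCLM‖ * K ^ 2) := by
        rw [norm_smul, norm_smul, Real.norm_eq_abs, abs_of_pos hc₀, Real.norm_eq_abs, abs_neg,
          abs_one, one_mul]
        exact mul_le_mul_of_nonneg_left (hbounds _ (hAO z hzQ)).2 hc₀.le
      have h0n : 0 ≤ c₀ * (3 * 1 * ‖curlCLM‖ * K + 2 * ‖curlCLM‖ * K ^ 2) := (norm_nonneg _).trans hn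
      calc ‖c₀ • ((-1 : ℝ) • Carleman.dt (uncurry (vorticity U)) (A z))‖ₑ ^ 2
          = ENNReal.ofReal (‖c₀ • ((-1 : ℝ) • Carleman.dt (uncurry (vorticity U)) (A z))‖ ^ 2) := by
            rw [← ofReal_norm, ENNReal.ofReal_pow (norm_nonneg _)]
        _ ≤ ENNReal.ofReal ((c₀ * (3 * 1 * ‖curlCLM‖ * K + 2 * ‖curlCLM‖ * K ^ 2)) ^ 2) :=
            ENNReal.ofReal_le_ofReal (pow_le_pow_left₀ (norm_nonneg _) hn 2)
    calc ∫⁻ z in K', ‖Carleman.dt u z‖ₑ ^ 2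
        ≤ ∫⁻ _ in K', ENNReal.ofReal ((c₀ * (3 * 1 * ‖curlCLM‖ * K + 2 * ‖curlCLM‖ * K ^ 2)) ^ 2) := setLIntegral_mono' hK'm hbd
      _ = ENNReal.ofReal ((c₀ * (3 * 1 * ‖curlCLM‖ * K + 2 * ‖curlCLM‖ * K ^ 2)) ^ 2) * volume K' := setLIntegral_const _ _
      _ < ∞ := ENNReal.mul_lt_top ENNReal.ofReal_lt_top hK'b.measure_lt_top
  -- ### (hcont) continuity up to the initial plane
  have hutcQ : ∀ z ∈ Q, ContinuousAt ut z := by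
    intro z hz
    have h1 : ContinuousAt (uncurry (vorticity U)) (A z) := hω1.continuousOn.continuousAt (hOo.mem_nhds (hAO z hz))
    have h2 : ContinuousAt A z := (continuous_stAffine (-1 : ℝ) 1 0 x₀).continuousAt
    exact (h1.comp_of_eq h2 rfl).const_smul c₀
  have hcont : ContinuousOn u (Ico (0 : ℝ) 1 ×ˢ H) := by
    rintro ⟨s', y⟩ ⟨hs', hy⟩
    rcases (hs'.1).eq_or_lt with h0s | hspos
    · -- the bottom `s' = 0`
      subst h0s
      rw [Metric.continuousWithinAt_iff]
      intro ε hε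
      set θ : ℝ := ε / (2 * (c₀ * ‖curlCLM‖ + 1)) with hθdef
      have hθ : 0 < θ := by positivity
      have hθε : c₀ * ‖curlCLM‖ * θ < ε := by
        have h1 : c₀ * ‖curlCLM‖ * θ ≤ (c₀ * ‖curlCLM‖ + 1) * θ := by nlinarith
        have h2 : (c₀ * ‖curlCLM‖ + 1) * θ = ε / 2 := by rw [hθdef]; field_simp
        linarith
      obtain ⟨s₀, δ₁, hs₀, -, hδ₁, hsm⟩ := hsmall (x₀ + y) (hx₀S y hy) θ hθ
      refine ⟨min (-s₀) δ₁, lt_min (by linarith) hδ₁, ?_⟩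
      rintro ⟨s'', y'⟩ ⟨hs'', hy'⟩ hdist
      rw [Prod.dist_eq, max_lt_iff] at hdist
      obtain ⟨hd1, hd2⟩ := hdist
      rw [Real.dist_eq, sub_zero] at hd1
      have hu0 : u (0, y) = 0 := if_neg (lt_irrefl 0)
      rw [hu0, dist_zero_right]
      rcases (hs''.1).eq_or_lt with h0 | hpos
      · have hs0 : s'' = 0 := by simpa using h0.symm
        have : u (s'', y') = 0 := by
          show (if (0 : ℝ) < s'' then ut (s'', y') else 0) = 0
          rw [hs0, if_neg (lt_irrefl 0)]
        rw [this, norm_zero]; exact hε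
      · have hzQ : ((s'', y') : ℝ × (EuclideanSpace ℝ (Fin 3))) ∈ Q := ⟨⟨hpos, hs''.2⟩, hy'⟩
        rw [huQ _ hzQ, hnormut, hA]
        have hs''abs : |s''| = s'' := abs_of_pos hpos
        have hneg : -s'' ∈ Ioo s₀ 0 := ⟨by
            have : s'' < -s₀ := by rw [← hs''abs]; exact hd1.trans_le (min_le_left _ _)
            linarith, by linarith⟩
        have hball : x₀ + y' ∈ ball (x₀ + y) δ₁ := by
          rw [mem_ball, dist_eq_norm, add_sub_add_left_eq_sub, ← dist_eq_norm]
          exact hd2.trans_le (min_le_right _ _)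
        obtain ⟨-, hD⟩ := hsm (-s'') hneg (x₀ + y') hball
        have hω : ‖(uncurry (vorticity U)) (-s'', x₀ + y')‖ ≤ ‖curlCLM‖ * θ := by
          show ‖vorticity U (-s'') (x₀ + y')‖ ≤ ‖curlCLM‖ * θ
          rw [vorticity_apply]
          exact (norm_curl_le _ _).trans (mul_le_mul_of_nonneg_left hD hκ0)
        calc c₀ * ‖(uncurry (vorticity U)) (-s'', x₀ + y')‖ ≤ c₀ * (‖curlCLM‖ * θ) := mul_le_mul_of_nonneg_left hω hc₀.le
          _ = c₀ * ‖curlCLM‖ * θ := by ring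
          _ < ε := hθε
    · -- interior points `s' > 0`
      have hzQ : ((s', y) : ℝ × (EuclideanSpace ℝ (Fin 3))) ∈ Q := ⟨⟨hspos, hs'.2⟩, hy⟩
      have hev : u =ᶠ[𝓝 ((s', y) : ℝ × (EuclideanSpace ℝ (Fin 3)))] ut := by
        filter_upwards [(isOpen_lt continuous_const continuous_fst).mem_nhds
          (show (0 : ℝ) < ((s', y) : ℝ × (EuclideanSpace ℝ (Fin 3))).1 from hspos)] with z hz
        exact if_pos hz
      exact ((hutcQ _ hzQ).congr_of_eventuallyEq hev).continuousWithinAt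
  -- ### backward uniqueness
  have hzero := Carleman.backwardUniqueness_uncurried_c12 (E := (EuclideanSpace ℝ (Fin 3))) (F := (EuclideanSpace ℝ (Fin 3)))
    uniqueContinuation_input_c12 he (c₁ := 2 * K) (M := 0) (by positivity) le_rfl hu1 hux hcont h0
    hBH hgrowth hH3
  -- ### conclusion
  intro t ht x hx
  set z : ℝ × (EuclideanSpace ℝ (Fin 3)) := (-t, x - x₀) with hzdef
  have hxH : x - x₀ ∈ H := by
    show 0 < ⟪x - x₀, e⟫
    rw [inner_sub_left, hx₀def, real_inner_smul_left, real_inner_self_eq_norm_sq, he]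
    nlinarith
  have hzQ : z ∈ Q := ⟨⟨by linarith [ht.2], by linarith [ht.1]⟩, hxH⟩
  have h := hzero z hzQ
  rw [huQ z hzQ, hutdef] at h
  have h' : (uncurry (vorticity U)) (A z) = 0 := by
    rcases smul_eq_zero.1 h with h1 | h1
    · exact absurd h1 hc₀.ne'
    · exact h1
  have hAz : A z = (t, x) := by
    rw [hA]; simp [hzdef]
  rw [hAz] at h'
  simpa [vorticity_apply] using h'

end FarField

/-! ## Part III. No concentration, and ESS Thm. 1.4 -/
variable {w : ℝ → EuclideanSpace ℝ (Fin 3) → EuclideanSpace ℝ (Fin 3)}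
  {π : ℝ → EuclideanSpace ℝ (Fin 3) → ℝ}

/-! ### The far field of the blow-up limit -/

section FarField

/-- **The far-field representative of the blow-up limit and the vanishing of its vorticity**
(ESS 2003, §3, (3.26)–(3.32); Seregin 2014, §6.6, Thm. 6.21 and (6.6.13)). If `|w| ≤ 1` a.e.
on `]-2, 0[ × {|x| > R₀}` and `π ∈ L^{3/2}(]-2, 0[ × ℝ³)`, then on `]-1, 0[ × {|x| > R₀ + 1}`
the limit `w` has a jointly continuous representative `U` with smooth slices
(`exists_representative_of_ae_bound`, from `NSBoundedHigherRegularityBounds`), and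
`curl U = 0` on `]-1, 0[ × {|x| > R₀ + 2}` (`farField_curl_eq_zero`: backward uniqueness
across the half-spaces, the vorticity vanishing at the top time by the weak vanishing `htop`
of the limit). [cite: EscauriazaSereginSverak2003, §3 (3.26)–(3.32)] [cite: Seregin2014, §6.6 Thm. 6.21] -/
theorem blowup_farField_representative (hB : NSBoundedHigherRegularityBounds)
    (hw : ∀ a : ℝ, 0 < a →
      IsSuitableWeakSolutionInBall a (0 : ℝ × EuclideanSpace ℝ (Fin 3)) w π)
    (hπ : ∫⁻ z in Ioo (-2) 0 ×ˢ (univ : Set (EuclideanSpace ℝ (Fin 3))),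
      ‖π z.1 z.2‖ₑ ^ (3 / 2 : ℝ) < ∞)
    (htop : ∀ φ : EuclideanSpace ℝ (Fin 3) → EuclideanSpace ℝ (Fin 3), ContDiff ℝ (⊤ : ℕ∞) φ →
      HasCompactSupport φ → ∀ ε : ℝ, 0 < ε →
        ∃ s₀ : ℝ, s₀ < 0 ∧ ∀ᵐ s ∂(volume.restrict (Ioo s₀ 0)), |∫ y, ⟪w s y, φ y⟫| ≤ ε)
    {R₀ : ℝ} (hR₀ : 0 < R₀)
    (hfar : ∀ᵐ z ∂(volume.restrict
      (Ioo (-2 : ℝ) 0 ×ˢ (closedBall (0 : EuclideanSpace ℝ (Fin 3)) R₀)ᶜ)), ‖w z.1 z.2‖ ≤ 1) :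
    ∃ Uf : ℝ → EuclideanSpace ℝ (Fin 3) → EuclideanSpace ℝ (Fin 3),
      uncurry Uf =ᵐ[volume.restrict
        (Ioo (-1 : ℝ) 0 ×ˢ (closedBall (0 : EuclideanSpace ℝ (Fin 3)) (R₀ + 1))ᶜ)] uncurry w ∧
      ContinuousOn (uncurry Uf)
        (Ioo (-1 : ℝ) 0 ×ˢ (closedBall (0 : EuclideanSpace ℝ (Fin 3)) (R₀ + 1))ᶜ) ∧
      ∀ z ∈ Ioo (-1 : ℝ) 0 ×ˢ {x : EuclideanSpace ℝ (Fin 3) | R₀ + 1 + 1 < ‖x‖},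
        curl (Uf z.1) z.2 = 0 := by
  -- the thickening condition and the bound in the required shape
  have hSS' : ∀ x ∈ (closedBall (0 : EuclideanSpace ℝ (Fin 3)) (R₀ + 1))ᶜ,
      ball x (2 * (1 / 2 : ℝ)) ⊆ (closedBall (0 : EuclideanSpace ℝ (Fin 3)) R₀)ᶜ := by
    intro x hx y hy
    rw [mem_compl_iff, mem_closedBall, dist_zero_right, not_le] at hx ⊢
    rw [mem_ball, dist_eq_norm] at hy
    have : ‖x‖ ≤ ‖y‖ + ‖y - x‖ := by
      calc ‖x‖ = ‖y - (y - x)‖ := by rw [sub_sub_cancel]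
        _ ≤ ‖y‖ + ‖y - x‖ := norm_sub_le _ _
    linarith
  have hbd : ∀ᵐ z ∂(volume.restrict (Ioo ((-1 : ℝ) - 4 * (1 / 2 : ℝ) ^ 2) 0 ×ˢ
      (closedBall (0 : EuclideanSpace ℝ (Fin 3)) R₀)ᶜ)), ‖w z.1 z.2‖ ≤ 1 := by
    rw [show (-1 : ℝ) - 4 * (1 / 2 : ℝ) ^ 2 = -2 by norm_num]
    exact hfar
  obtain ⟨K, U, hUw, hUc, hCD, hjc, hbdK⟩ := exists_representative_of_ae_bound hB hw hπ
    isClosed_closedBall.isOpen_compl (by norm_num : (0 : ℝ) < 1 / 2)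
    (by norm_num : (-2 : ℝ) ≤ -1 - 4 * (1 / 2 : ℝ) ^ 2) le_rfl hSS' hbd
  refine ⟨U, hUw, hUc, ?_⟩
  -- notation
  set S : Set (EuclideanSpace ℝ (Fin 3)) := (closedBall (0 : EuclideanSpace ℝ (Fin 3)) (R₀ + 1))ᶜ with hS
  have hSo : IsOpen S := isClosed_closedBall.isOpen_compl
  set Ω : Set (ℝ × EuclideanSpace ℝ (Fin 3)) := Ioo (-1 : ℝ) 0 ×ˢ S with hΩ
  have hΩo : IsOpen Ω := isOpen_Ioo.prod hSo
  -- the equations hold for the representative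
  have hsolw : IsDistributionalNSSolutionOn ⟨Ω, hΩo⟩ 1 0 w π :=
    isDistributionalNSSolutionOn_of_forall_cylinder (fun a' ha' => (hw a' ha').1.distributional)
      hΩo (prod_mono Ioo_subset_Iio_self (subset_univ _))
  have hsol : IsDistributionalNSSolutionOn ⟨Ω, hΩo⟩ 1 0 U π :=
    hsolw.congr_ae hUw.symm (ae_of_all _ fun _ => rfl)
  have hU4 : ∀ t ∈ Ioo (-1 : ℝ) 0, ContDiffOn ℝ 4 (U t) S := fun t ht x hx =>
    ((hCD (t, x) ⟨ht, hx⟩).of_le (by norm_cast)).contDiffWithinAt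
  have hΦ : ∀ n ≤ 4, ContinuousOn
      (fun z : ℝ × EuclideanSpace ℝ (Fin 3) => iteratedFDeriv ℝ n (U z.1) z.2) Ω := fun n _ => hjc n
  have hK : ∀ n ≤ 3, ∀ z ∈ Ω, ‖iteratedFDeriv ℝ n (U z.1) z.2‖ ≤ K :=
    fun n hn z hz => hbdK n (by omega) z hz
  exact farField_curl_eq_zero (by linarith : (0 : ℝ) ≤ R₀ + 1) htop hUw hsol hU4 hΦ hK

end FarField

/-! ### The interior step: unique continuation and Liouville on a bounded strip -/

section Strip

/-- **The interior step of ESS 2003, Thm. 1.4** (§3, after (3.32); Seregin 2014, Ch. 7 p. 139;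
Robinson–Rodrigo–Sadowski 2016, proof of Thm. 16.2, Step 5). Let `(w, π)` be the blow-up limit
(suitable in every `Q(a)`, sliced `L³` bound `M`, `π ∈ L^{3/2}(]-1,0[ × ℝ³)`), let `Uf` be its
far-field representative on `]-1, 0[ × {|x| > R₁}` with `curl Uf = 0` for `|x| > R₁ + 1`, and
let `]a, b[ × ℝ³ ⊆ ]-1, 0] × ℝ³` be a strip with `|w| ≤ L` a.e. on `]a - 4ρ², b[ × ℝ³`. Then
`w(s, ·) = 0` a.e. for a.e. `s ∈ ]a, b[`. Proof: the smooth representative `U` on the strip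
(`exists_representative_of_ae_bound`) has vorticity `ω` of class `C¹₂` with
`|∂ₜω - Δω| ≤ 2K(|ω| + |∇ω|)` (`vorticity_c12_of_isDistributionalNSSolutionOn`,
`vorticity_carleman_inequality`); `U = Uf` on the far part of the strip (continuity), so
`ω = 0` there; at every time `t` of the strip the time-reversed, translated vorticity
`(s, y) ↦ ω(t - s, x₁ + y)`, `|x₁| = R₁ + 3`, vanishes identically near the apex and satisfies
the hypotheses of the unique continuation theorem `Carleman.uniqueContinuation_uncurried_c12`
on `]0, t - a[ × B(0, 2R₁ + 10)`, whence `ω(t, ·) ≡ 0`; then `U(t, ·)` is smooth, divergence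
free and irrotational, hence harmonic (`laplacian_eq_zero_of_curl_eq_zero_of_isDivFree`), and
for a.e. `t` it equals `w(t, ·) ∈ L³(ℝ³)` a.e., so it vanishes
(`eq_zero_of_harmonic_memLp_inner`). [cite: EscauriazaSereginSverak2003, §3 after (3.32) and Thm. 4.1] [cite: Seregin2014, Ch. 7 p. 139] -/
theorem strip_velocity_ae_zero (hB : NSBoundedHigherRegularityBounds) {M : ℝ≥0}
    (hw : ∀ a : ℝ, 0 < a →
      IsSuitableWeakSolutionInBall a (0 : ℝ × EuclideanSpace ℝ (Fin 3)) w π)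
    (hM : ∀ a : ℝ, 0 < a → ∀ᵐ s ∂(volume.restrict (Ioo (-a ^ 2) 0)),
      ∫⁻ y in ball (0 : EuclideanSpace ℝ (Fin 3)) a, ‖w s y‖ₑ ^ (3 : ℕ) ≤ M)
    (hπ : ∫⁻ z in Ioo (-1) 0 ×ˢ (univ : Set (EuclideanSpace ℝ (Fin 3))),
      ‖π z.1 z.2‖ₑ ^ (3 / 2 : ℝ) < ∞)
    {R₁ : ℝ} (hR₁ : 0 < R₁) {Uf : ℝ → EuclideanSpace ℝ (Fin 3) → EuclideanSpace ℝ (Fin 3)}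
    (hUf : uncurry Uf =ᵐ[volume.restrict
      (Ioo (-1 : ℝ) 0 ×ˢ (closedBall (0 : EuclideanSpace ℝ (Fin 3)) R₁)ᶜ)] uncurry w)
    (hUfc : ContinuousOn (uncurry Uf)
      (Ioo (-1 : ℝ) 0 ×ˢ (closedBall (0 : EuclideanSpace ℝ (Fin 3)) R₁)ᶜ))
    (hcurl : ∀ z ∈ Ioo (-1 : ℝ) 0 ×ˢ {x : EuclideanSpace ℝ (Fin 3) | R₁ + 1 < ‖x‖},
      curl (Uf z.1) z.2 = 0)
    {a b ρ L : ℝ} (hρ : 0 < ρ) (ha : -1 ≤ a - 4 * ρ ^ 2) (hb : b ≤ 0)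
    (hbd : ∀ᵐ z ∂(volume.restrict
      (Ioo (a - 4 * ρ ^ 2) b ×ˢ (univ : Set (EuclideanSpace ℝ (Fin 3))))), ‖w z.1 z.2‖ ≤ L) :
    ∀ᵐ s ∂(volume.restrict (Ioo a b)), w s =ᵐ[volume] 0 := by
  -- ### the representative on the strip
  set I : Set ℝ := Ioo a b with hIdef
  have hIo : IsOpen I := isOpen_Ioo
  set Ω : Set (ℝ × EuclideanSpace ℝ (Fin 3)) := I ×ˢ (univ : Set (EuclideanSpace ℝ (Fin 3))) with hΩdef
  have hΩo : IsOpen Ω := hIo.prod isOpen_univ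
  have hIsub : I ⊆ Ioo (-1 : ℝ) 0 := Ioo_subset_Ioo (by nlinarith [sq_nonneg ρ]) hb
  obtain ⟨K, U, hUw, hUc, hCD, hjc, hbdK⟩ := exists_representative_of_ae_bound hB hw hπ
    (S := univ) (S' := univ) isOpen_univ hρ ha hb (fun x _ => subset_univ _) hbd
  -- the equations hold for the representative
  have hsolw : IsDistributionalNSSolutionOn ⟨Ω, hΩo⟩ 1 0 w π :=
    isDistributionalNSSolutionOn_of_forall_cylinder (fun a' ha' => (hw a' ha').1.distributional)
      hΩo (prod_mono (hIsub.trans Ioo_subset_Iio_self) Subset.rfl)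
  have hsol : IsDistributionalNSSolutionOn ⟨Ω, hΩo⟩ 1 0 U π :=
    hsolw.congr_ae hUw.symm (ae_of_all _ fun _ => rfl)
  have hU4 : ∀ t ∈ I, ContDiffOn ℝ 4 (U t) (univ : Set (EuclideanSpace ℝ (Fin 3))) :=
    fun t ht x _ =>
      ((hCD (t, x) ⟨ht, mem_univ _⟩).of_le (by norm_cast)).contDiffWithinAt
  have hΦ : ∀ n ≤ 4, ContinuousOn
      (fun z : ℝ × EuclideanSpace ℝ (Fin 3) => iteratedFDeriv ℝ n (U z.1) z.2) Ω := fun n _ => hjc n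
  have hK₀ : ∀ z ∈ Ω, ‖U z.1 z.2‖ ≤ K := fun z hz => by
    have h := hbdK 0 (by norm_num) z hz
    rwa [norm_iteratedFDeriv_zero] at h
  have hK₁ : ∀ z ∈ Ω, ‖fderiv ℝ (U z.1) z.2‖ ≤ K := fun z hz => by
    have h := hbdK 1 (by norm_num) z hz
    rwa [norm_iteratedFDeriv_one] at h
  -- ### the vorticity: class `C¹₂`, equation, far-field vanishing
  obtain ⟨hdiv, -, -, hω1, hωx⟩ :=
    vorticity_c12_of_isDistributionalNSSolutionOn hIo isOpen_univ hsol hU4 hΦ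
  obtain ⟨-, -, hineq⟩ := vorticity_carleman_inequality hIo isOpen_univ hsol hU4 hΦ hK₀ hK₁
  have hωbd : ∀ z ∈ Ω, ‖(uncurry (vorticity U)) z‖ ≤ ‖curlCLM‖ * K := fun z hz => by
    show ‖vorticity U z.1 z.2‖ ≤ _
    rw [vorticity_apply]
    exact (norm_curl_le _ _).trans
      (mul_le_mul_of_nonneg_left (hK₁ z hz) (ContinuousLinearMap.opNorm_nonneg curlCLM))
  have hfarΩ : ∀ z ∈ I ×ˢ {x : EuclideanSpace ℝ (Fin 3) | R₁ + 1 < ‖x‖}, vorticity U z.1 z.2 = 0 := by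
    set O : Set (ℝ × EuclideanSpace ℝ (Fin 3)) := I ×ˢ (closedBall (0 : EuclideanSpace ℝ (Fin 3)) R₁)ᶜ with hO
    have hOo : IsOpen O := hIo.prod isClosed_closedBall.isOpen_compl
    have hOΩ : O ⊆ Ω := prod_mono Subset.rfl (subset_univ _)
    have hOF : O ⊆ Ioo (-1 : ℝ) 0 ×ˢ (closedBall (0 : EuclideanSpace ℝ (Fin 3)) R₁)ᶜ :=
      prod_mono hIsub Subset.rfl
    have hae1 : uncurry U =ᵐ[volume.restrict O] uncurry w :=
      ae_restrict_of_ae_restrict_of_subset hOΩ hUw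
    have hae2 : uncurry Uf =ᵐ[volume.restrict O] uncurry w :=
      ae_restrict_of_ae_restrict_of_subset hOF hUf
    have hae : uncurry U =ᵐ[volume.restrict O] uncurry Uf := hae1.trans hae2.symm
    have heqOn : EqOn (uncurry U) (uncurry Uf) O :=
      Measure.eqOn_open_of_ae_eq hae hOo (hUc.mono hOΩ) (hUfc.mono hOF)
    rintro ⟨t, x⟩ ⟨ht, hx⟩
    have hx' : R₁ + 1 < ‖x‖ := hx
    have hxc : x ∈ (closedBall (0 : EuclideanSpace ℝ (Fin 3)) R₁)ᶜ := by
      rw [mem_compl_iff, mem_closedBall, dist_zero_right, not_le]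
      linarith
    have hev : U t =ᶠ[𝓝 x] Uf t := slice_eventuallyEq hOo heqOn (w := (t, x)) ⟨ht, hxc⟩
    show vorticity U t x = 0
    rw [vorticity_apply, curl_eq_curlCLM, hev.fderiv_eq, ← curl_eq_curlCLM]
    exact hcurl (t, x) ⟨hIsub ht, hx'⟩
  -- ### unique continuation across the sphere `|x| = R₁ + 1`, at every time of the strip
  have hωzero : ∀ t ∈ I, ∀ x : EuclideanSpace ℝ (Fin 3), vorticity U t x = 0 := by
    intro t ht x
    by_cases hxfar : R₁ + 1 < ‖x‖
    · exact hfarΩ (t, x) ⟨ht, hxfar⟩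
    push Not at hxfar
    -- constants
    have hK0 : 0 ≤ K := (norm_nonneg _).trans (hK₀ (t, 0) ⟨ht, mem_univ _⟩)
    set e₀ : EuclideanSpace ℝ (Fin 3) := EuclideanSpace.basisFun (Fin 3) ℝ 0 with he₀
    have he₀n : ‖e₀‖ = 1 := (EuclideanSpace.basisFun (Fin 3) ℝ).orthonormal.1 0
    set x₁ : EuclideanSpace ℝ (Fin 3) := (R₁ + 3) • e₀ with hx₁
    have hx₁n : ‖x₁‖ = R₁ + 3 := by
      rw [hx₁, norm_smul, he₀n, mul_one, Real.norm_eq_abs, abs_of_pos (by linarith)]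
    set Rb : ℝ := 2 * R₁ + 10 with hRb
    have hRbpos : 0 < Rb := by positivity
    set T' : ℝ := t - a with hT'
    have hT'pos : 0 < T' := by have := ht.1; simp only [hT']; linarith
    -- the affine map `A(s, y) = (t - s, x₁ + y)`
    set A : ℝ × EuclideanSpace ℝ (Fin 3) → ℝ × EuclideanSpace ℝ (Fin 3) := stAffine (-1) 1 t x₁ with hAdef
    have hA1 : ∀ z : ℝ × EuclideanSpace ℝ (Fin 3), (A z).1 = t - z.1 := fun z => by
      show t + (-1) * z.1 = t - z.1; ring
    have hA2 : ∀ z : ℝ × EuclideanSpace ℝ (Fin 3), (A z).2 = x₁ + z.2 := fun z => by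
      show x₁ + (1 : ℝ) • z.2 = x₁ + z.2; rw [one_smul]
    set Q' : Set (ℝ × EuclideanSpace ℝ (Fin 3)) := Ioo (0 : ℝ) T' ×ˢ ball (0 : EuclideanSpace ℝ (Fin 3)) Rb with hQ'
    have hAΩ' : ∀ z ∈ Ico (0 : ℝ) T' ×ˢ ball (0 : EuclideanSpace ℝ (Fin 3)) Rb, A z ∈ Ω := by
      rintro ⟨s, y⟩ ⟨hs, -⟩
      refine ⟨?_, mem_univ _⟩
      rw [hA1]
      have h1 := hs.1
      have h2 := hs.2
      simp only [hT'] at h2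
      exact ⟨by simp only; linarith, by simp only; linarith [ht.2]⟩
    have hAΩ : ∀ z ∈ Q', A z ∈ Ω := fun z hz => hAΩ' z ⟨Ioo_subset_Ico_self hz.1, hz.2⟩
    -- the transported vorticity
    set ω : ℝ × EuclideanSpace ℝ (Fin 3) → EuclideanSpace ℝ (Fin 3) := uncurry (vorticity U) with hωdef
    set u : ℝ × EuclideanSpace ℝ (Fin 3) → EuclideanSpace ℝ (Fin 3) := fun z => ω (A z) with hudef
    have hu1 : ContDiffOn ℝ 1 u Q' :=
      (Carleman.contDiffOn_comp_stAffine hω1 (-1) 1 t x₁).mono fun z hz => hAΩ z hz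
    have hdxu : ∀ e : EuclideanSpace ℝ (Fin 3), Carleman.dx e u = fun z => Carleman.dx e ω (A z) := by
      intro e
      funext z
      rw [hudef, Carleman.dx_comp_stAffine (by norm_num) one_ne_zero ω e z, one_smul]
    have hux : ∀ e : EuclideanSpace ℝ (Fin 3), ContDiffOn ℝ 1 (Carleman.dx e u) Q' := by
      intro e
      rw [hdxu e]
      exact (Carleman.contDiffOn_comp_stAffine (hωx e) (-1) 1 t x₁).mono fun z hz => hAΩ z hz
    have hucont : ContinuousOn u (Ico (0 : ℝ) T' ×ˢ ball (0 : EuclideanSpace ℝ (Fin 3)) Rb) :=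
      (Carleman.continuousOn_comp_stAffine hω1.continuousOn (-1) 1 t x₁).mono fun z hz => hAΩ' z hz
    have hdtu : ∀ z, Carleman.dt u z = (-1 : ℝ) • Carleman.dt ω (A z) := fun z => by
      rw [hudef, Carleman.dt_comp_stAffine (by norm_num) one_ne_zero]
    have hlapu : ∀ z, Carleman.lap u z = Carleman.lap ω (A z) := fun z => by
      rw [hudef, Carleman.lap_comp_stAffine (by norm_num) one_ne_zero, one_pow, one_smul]
    have hgradu : ∀ z, Carleman.gradSq u z = Carleman.gradSq ω (A z) := fun z => by
      rw [hudef, Carleman.gradSq_comp_stAffine (by norm_num) one_ne_zero, one_pow, one_mul]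
    have hinequ : ∀ z ∈ Q', ‖Carleman.dt u z + Carleman.lap u z‖ ≤
        (K + K) * (‖u z‖ + Real.sqrt (Carleman.gradSq u z)) := by
      intro z hz
      rw [hdtu z, hlapu z, hgradu z]
      have e1 : (-1 : ℝ) • Carleman.dt ω (A z) + Carleman.lap ω (A z) =
          -(Carleman.dt ω (A z) - Carleman.lap ω (A z)) := by
        rw [neg_one_smul]; abel
      rw [e1, norm_neg]
      exact hineq (A z) (hAΩ z hz)
    have hvan : ∀ k : ℕ, ∃ C : ℝ, ∀ z ∈ Q', ‖u z‖ ≤ C * (‖z.2‖ + Real.sqrt z.1) ^ k := by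
      intro k
      refine ⟨‖curlCLM‖ * K, fun z hz => ?_⟩
      have hbase : 0 ≤ ‖z.2‖ + Real.sqrt z.1 := by positivity
      by_cases hy : ‖z.2‖ < 2
      · -- near the apex the transported vorticity vanishes identically
        have hfar' : R₁ + 1 < ‖x₁ + z.2‖ := by
          have h := norm_sub_le (x₁ + z.2) z.2
          rw [add_sub_cancel_right, hx₁n] at h
          linarith
        have h0 : u z = 0 := by
          have h := hfarΩ (A z) ⟨(hAΩ z hz).1, by rw [hA2]; exact hfar'⟩
          show ω (A z) = 0
          exact h
        rw [h0, norm_zero]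
        positivity
      · push Not at hy
        have h1 : (1 : ℝ) ≤ (‖z.2‖ + Real.sqrt z.1) ^ k :=
          one_le_pow₀ (by linarith [Real.sqrt_nonneg z.1])
        calc ‖u z‖ = ‖ω (A z)‖ := rfl
          _ ≤ ‖curlCLM‖ * K := hωbd _ (hAΩ z hz)
          _ = ‖curlCLM‖ * K * 1 := (mul_one _).symm
          _ ≤ ‖curlCLM‖ * K * (‖z.2‖ + Real.sqrt z.1) ^ k :=
              mul_le_mul_of_nonneg_left h1 (by positivity)
    have huc := Carleman.uniqueContinuation_uncurried_c12 3 3 (c₁ := K + K) (R := Rb) (T := T')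
      (by positivity) hRbpos hT'pos hu1 hux hucont hinequ hvan
    -- evaluate at `y = x - x₁`
    have hy : x - x₁ ∈ ball (0 : EuclideanSpace ℝ (Fin 3)) Rb := by
      rw [mem_ball_zero_iff]
      calc ‖x - x₁‖ ≤ ‖x‖ + ‖x₁‖ := norm_sub_le _ _
        _ < Rb := by rw [hx₁n, hRb]; linarith
    have h := huc (x - x₁) hy
    have hA0 : A (0, x - x₁) = (t, x) := by
      show (t + (-1) * (0 : ℝ), x₁ + (1 : ℝ) • (x - x₁)) = (t, x)
      simp
    have h' : ω (A (0, x - x₁)) = 0 := h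
    rw [hA0] at h'
    exact h'
  -- ### the velocity slices are harmonic
  have hharm : ∀ t ∈ I, InnerProductSpace.HarmonicOnNhd (U t) (univ : Set (EuclideanSpace ℝ (Fin 3))) := by
    intro t ht x _
    have hcd : ContDiff ℝ 2 (U t) := contDiff_iff_contDiffAt.2 fun y =>
      (hCD (t, y) ⟨ht, mem_univ _⟩).of_le (by norm_cast)
    have hΔ : ∀ y, Δ (U t) y = 0 :=
      laplacian_eq_zero_of_curl_eq_zero_of_isDivFree hcd
        (fun y => by rw [← vorticity_apply]; exact hωzero t ht y)
        (fun y => hdiv (t, y) ⟨ht, mem_univ _⟩)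
    show InnerProductSpace.HarmonicAt (U t) x
    constructor
    · exact hcd.contDiffAt
    · exact Filter.Eventually.of_forall fun y => by rw [Pi.zero_apply]; exact hΔ y
  -- ### a.e. slice: `U(t) = w(t)` a.e. and `w(t) ∈ L³`, so `U(t) = 0`
  have hwm : ∀ a' : ℝ, 0 < a' → AEStronglyMeasurable (uncurry w)
      (volume.restrict (parabolicCylinder a' (0 : ℝ × EuclideanSpace ℝ (Fin 3)))) :=
    fun a' ha' => (hw a' ha').1.distributional.1.aestronglyMeasurable
  have hslice : ∀ᵐ t ∂(volume.restrict I), U t =ᵐ[volume] w t := by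
    have h1 : ∀ᵐ z ∂((volume.restrict I).prod (volume : Measure (EuclideanSpace ℝ (Fin 3)))),
        uncurry U z = uncurry w z := by
      rw [Measure.restrict_prod_eq_prod_univ, ← Measure.volume_eq_prod]
      exact hUw
    filter_upwards [Measure.ae_ae_of_ae_prod h1] with t ht
    filter_upwards [ht] with x hx
    exact hx
  have hL3 : ∀ᵐ t ∂(volume.restrict I),
      AEStronglyMeasurable (w t) volume ∧ ∫⁻ y, ‖w t y‖ₑ ^ (3 : ℕ) ≤ M :=
    ae_restrict_of_ae_restrict_of_subset (hIsub.trans Ioo_subset_Iio_self)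
      (ae_lintegral_univ_cube_le hwm hM)
  filter_upwards [ae_restrict_mem measurableSet_Ioo, hslice, hL3] with t ht hUt hL3t
  obtain ⟨hsm, hle⟩ := hL3t
  have hmem : MemLp (w t) 3 volume := by
    refine ⟨hsm, ?_⟩
    rw [eLpNorm_three_eq_lintegral_cube_rpow]
    exact ENNReal.rpow_lt_top_of_nonneg (by norm_num) (lt_of_le_of_lt hle ENNReal.coe_lt_top).ne
  have hmemU : MemLp (U t) 3 volume := hmem.ae_eq hUt.symm
  have hU0 : U t = 0 :=
    eq_zero_of_harmonic_memLp_inner (hharm t ht) (q := 3) (by norm_num) (by norm_num) hmemU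
  filter_upwards [hUt] with x hx
  rw [← hx, hU0]

end Strip

/-! ### No concentration, and ESS Thm. 1.4 -/

section Assembly

/-- **No point of `Q̄(1/2)` is a point of `ε`-concentration** (ESS 2003, §3, proof of
Thm. 1.4 by contradiction; Seregin 2014, §6.6, Prop. 6.20 and Thm. 6.21; Robinson–Rodrigo–Sadowski
2016, proof of Thm. 16.2, Steps 3–5), from `NSBoundedHigherRegularityBounds`. If `(v, p)`
satisfies (1.15)–(1.16) on `Q(1)`, `z₀ ∈ Q̄(1/2)` and `ε > 0`, then
`r⁻² ∫_{Q(z₀,r)} (|v|³ + |p|^{3/2}) < ε` for some `0 < r ≤ 1/2`. Otherwise the velocity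
concentrates at every scale (`exists_cknC_ge_of_concentration`), the blow-up limit `(w, π)`
(`exists_blowup_limit`) is a suitable weak solution on `ℝ³ × ]-∞, 0[` with
`∫_{Q(1/2)} |w|³ ≥ η/4 > 0` (`blowup_lintegral_cube_ge`), bounded in the far field
(`exists_farField_ae_norm_le_one`) with vanishing far-field vorticity
(`blowup_farField_representative`); by the CKN theorem almost every time `t ∈ ]-1/4, 0[` is
regular (`ae_forall_isRegularPoint`), carries a bounded strip (`exists_strip_bound`) on which
`w = 0` a.e. (`strip_velocity_ae_zero`); so `w = 0` a.e. on `Q(1/2)` — a contradiction.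
[cite: EscauriazaSereginSverak2003, Thm. 1.4, §3] [cite: Seregin2014, §6.6 Prop. 6.20, Thm. 6.21] -/
theorem noConcentration_of_higherRegularityBounds (hB : NSBoundedHigherRegularityBounds) :
    ∀ (v : ℝ → EuclideanSpace ℝ (Fin 3) → EuclideanSpace ℝ (Fin 3)) (p : ℝ → EuclideanSpace ℝ (Fin 3) → ℝ),
      IsL3inftyLocalPair 1 1 ((0 : ℝ), (0 : EuclideanSpace ℝ (Fin 3))) v p →
      ∀ z ∈ closure (parabolicCylinder (1 / 2) ((0 : ℝ), (0 : EuclideanSpace ℝ (Fin 3)))), ∀ ε : ℝ, 0 < ε →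
        ∃ r ∈ Ioc (0 : ℝ) (1 / 2), ENNReal.ofReal ((r ^ 2)⁻¹) *
          ∫⁻ w in parabolicCylinder r z, (‖v w.1 w.2‖ₑ ^ 3 + ‖p w.1 w.2‖ₑ ^ (3 / 2 : ℝ)) <
            ENNReal.ofReal ε := by
  intro v p h z₀ hz₀ ε hε
  by_contra hcon
  push Not at hcon
  -- ### concentration of the velocity at every scale
  have hvmeas : AEStronglyMeasurable (uncurry v)
      (volume.restrict (parabolicCylinder 1 ((0 : ℝ), (0 : EuclideanSpace ℝ (Fin 3))))) :=
    (IsL3inftyLocalPair.unit_iff.1 h).1.1.aestronglyMeasurable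
  have hbad : ∀ r ∈ Ioc (0 : ℝ) (1 / 2), ENNReal.ofReal ε ≤ cknC r z₀ v + cknD r z₀ p := by
    intro r hr
    rw [← lintegral_cube_add_pressure_eq_cknC_add_cknD hr.1
      (hvmeas.mono_measure (Measure.restrict_mono
        (parabolicCylinder_subset_unit_of_mem_closure_half hz₀ hr.1.le hr.2) le_rfl))]
    exact hcon r hr
  obtain ⟨η, hη, hηC⟩ := exists_cknC_ge_of_concentration h hz₀ hε hbad
  obtain ⟨Mz, hMz⟩ := exists_ae_lintegral_ball_cube_zoom_le h
  obtain ⟨D, hDz⟩ := exists_cknD_le h hz₀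
  -- ### the blow-up limit and its properties
  obtain ⟨δ, w, π, -, hδge, hlim⟩ := exists_blowup_limit h hz₀
  have hw : ∀ a : ℝ, 0 < a →
      IsSuitableWeakSolutionInBall a (0 : ℝ × EuclideanSpace ℝ (Fin 3)) w π :=
    fun a ha => (hlim a ha).1
  have hwm : ∀ a : ℝ, 0 < a → MemLp (uncurry w) 3
      (volume.restrict (parabolicCylinder a (0 : ℝ × EuclideanSpace ℝ (Fin 3)))) :=
    fun a ha => (hlim a ha).2.1
  have hconv := fun a (ha : 0 < a) => (hlim a ha).2.2.1
  have hweak := fun a (ha : 0 < a) => (hlim a ha).2.2.2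
  have hM : ∀ a : ℝ, 0 < a → ∀ᵐ s ∂(volume.restrict (Ioo (-a ^ 2) 0)),
      ∫⁻ y in ball (0 : EuclideanSpace ℝ (Fin 3)) a, ‖w s y‖ₑ ^ (3 : ℕ) ≤ Mz :=
    fun a ha => blowup_ae_lintegral_ball_cube_le h hz₀ hδge (hMz z₀ hz₀) ha
      (hwm a ha).aestronglyMeasurable (hconv a ha)
  have hD : ∀ a : ℝ, 0 < a → cknD a (0 : ℝ × EuclideanSpace ℝ (Fin 3)) π ≤ D :=
    fun a ha => blowup_cknD_le h hz₀ hδge hDz ha (hw a ha).2.2.2 (hweak a ha)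
  have hlow : ENNReal.ofReal ((1 / 2 : ℝ) ^ 2 * η) ≤
      ∫⁻ z in parabolicCylinder (1 / 2) (0 : ℝ × EuclideanSpace ℝ (Fin 3)), ‖w z.1 z.2‖ₑ ^ (3 : ℕ) :=
    blowup_lintegral_cube_ge h hz₀ hδge hηC (by norm_num) (hwm _ (by norm_num)).aestronglyMeasurable
      (hconv _ (by norm_num))
  have htop : ∀ φ : EuclideanSpace ℝ (Fin 3) → EuclideanSpace ℝ (Fin 3), ContDiff ℝ (⊤ : ℕ∞) φ →
      HasCompactSupport φ → ∀ ε' : ℝ, 0 < ε' →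
        ∃ s₀ : ℝ, s₀ < 0 ∧ ∀ᵐ s ∂(volume.restrict (Ioo s₀ 0)), |∫ y, ⟪w s y, φ y⟫| ≤ ε' :=
    fun φ hφ hφc ε' hε' => blowup_top_vanishing h hz₀ hδge hwm hconv hφ hφc hε'
  -- ### the far field
  obtain ⟨R₀, hR₀, hfar⟩ := exists_farField_ae_norm_le_one hw hM hD (T := 2) two_pos
  have hπ2 := lintegral_pressure_slab_lt_top hw hM hD (T := 2) two_pos
  have hπ1 := lintegral_pressure_slab_lt_top hw hM hD (T := 1) one_pos
  obtain ⟨Uf, hUf, hUfc, hcurl⟩ := blowup_farField_representative hB hw hπ2 htop hR₀ hfar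
  have hfar1 : ∀ᵐ z ∂(volume.restrict
      (Ioo (-1 : ℝ) 0 ×ˢ (closedBall (0 : EuclideanSpace ℝ (Fin 3)) R₀)ᶜ)), ‖w z.1 z.2‖ ≤ 1 :=
    ae_restrict_of_ae_restrict_of_subset (prod_mono (Ioo_subset_Ioo (by norm_num) le_rfl) Subset.rfl) hfar
  -- ### regular times and their strips
  set a₂ : ℝ := R₀ + 2 with ha₂
  have ha₂pos : 0 < a₂ := by positivity
  have hreg : ∀ᵐ t ∂(volume.restrict (Ioo (-(1 / 4 : ℝ)) 0)),
      ∀ x ∈ ball (0 : EuclideanSpace ℝ (Fin 3)) a₂, IsRegularPoint w (t, x) := by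
    have hsub : Ioo (-(1 / 4 : ℝ)) 0 ⊆ Ioo (-a₂ ^ 2) 0 := Ioo_subset_Ioo (by nlinarith) le_rfl
    exact ae_restrict_of_ae_restrict_of_subset hsub (ae_forall_isRegularPoint (hw a₂ ha₂pos).1)
  -- the bad times
  set Ibad : Set ℝ := {s | ¬ (w s =ᵐ[volume] 0)} with hIbad
  have hG : ∀ᵐ t ∂(volume.restrict (Ioo (-(1 / 4 : ℝ)) 0)),
      ∃ J : Set ℝ, IsOpen J ∧ t ∈ J ∧ volume (Ibad ∩ J) = 0 := by
    filter_upwards [ae_restrict_mem measurableSet_Ioo, hreg] with t ht hregt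
    have ht1 : t ∈ Ioo (-1 : ℝ) 0 := ⟨by linarith [ht.1], ht.2⟩
    have hregc : ∀ x ∈ closedBall (0 : EuclideanSpace ℝ (Fin 3)) (R₀ + 1), IsRegularPoint w (t, x) :=
      fun x hx => hregt x (by
        rw [mem_closedBall, dist_zero_right] at hx
        rw [mem_ball_zero_iff, ha₂]; linarith)
    obtain ⟨τ, hτ, hτsub, L, hL⟩ := exists_strip_bound hfar1 hregc ht1
    have hτ1 : -1 ≤ t - τ := ((Ioo_subset_Ioo_iff (by linarith)).1 hτsub).1
    have hτ2 : t + τ ≤ 0 := ((Ioo_subset_Ioo_iff (by linarith)).1 hτsub).2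
    -- the strip `]t - τ/2, t + τ/2[` with `ρ = √τ/4`
    set ρ : ℝ := Real.sqrt τ / 4 with hρdef
    have hρ : 0 < ρ := by positivity
    have hρsq : 4 * ρ ^ 2 = τ / 4 := by
      rw [hρdef, div_pow, Real.sq_sqrt hτ.le]; ring
    have hbd : ∀ᵐ z ∂(volume.restrict
        (Ioo (t - τ / 2 - 4 * ρ ^ 2) (t + τ / 2) ×ˢ (univ : Set (EuclideanSpace ℝ (Fin 3))))),
        ‖w z.1 z.2‖ ≤ L := by
      refine ae_restrict_of_ae_restrict_of_subset (prod_mono (Ioo_subset_Ioo ?_ ?_) Subset.rfl) hL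
      · rw [hρsq]; linarith
      · linarith
    have hstrip := strip_velocity_ae_zero hB hw hM hπ1 (by linarith : (0 : ℝ) < R₀ + 1) hUf hUfc hcurl
      hρ (by rw [hρsq]; linarith) (by linarith) hbd
    refine ⟨Ioo (t - τ / 2) (t + τ / 2), isOpen_Ioo, ⟨by linarith, by linarith⟩, ?_⟩
    rw [← Measure.restrict_apply' measurableSet_Ioo]
    exact ae_iff.1 hstrip
  have hnull : volume (Ibad ∩ Ioo (-(1 / 4 : ℝ)) 0) = 0 := by
    set G : Set ℝ := {t | ∃ J : Set ℝ, IsOpen J ∧ t ∈ J ∧ volume (Ibad ∩ J) = 0} with hGdef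
    have h1 : volume.restrict (Ioo (-(1 / 4 : ℝ)) 0) {t | ¬ (∃ J : Set ℝ, IsOpen J ∧ t ∈ J ∧
        volume (Ibad ∩ J) = 0)} = 0 := ae_iff.1 hG
    rw [Measure.restrict_apply' measurableSet_Ioo] at h1
    have h2 : volume (Ibad ∩ G) = 0 := by
      refine measure_null_of_locally_null _ fun t ht => ?_
      obtain ⟨J, hJo, htJ, hJ0⟩ := ht.2
      have hsub : (Ibad ∩ G) ∩ J ⊆ Ibad ∩ J := fun s hs => ⟨hs.1.1, hs.2⟩
      exact ⟨(Ibad ∩ G) ∩ J, inter_mem_nhdsWithin _ (hJo.mem_nhds htJ), measure_mono_null hsub hJ0⟩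
    refine measure_mono_null (fun s hs => ?_) (measure_union_null h2 h1)
    by_cases hsG : s ∈ G
    · exact Or.inl ⟨hs.1, hsG⟩
    · exact Or.inr ⟨hsG, hs.2⟩
  have hae0 : ∀ᵐ t ∂(volume.restrict (Ioo (-(1 / 4 : ℝ)) 0)), w t =ᵐ[volume] 0 := by
    rw [ae_iff, Measure.restrict_apply' measurableSet_Ioo]
    exact hnull
  -- ### `w = 0` a.e. on `Q(1/2)`: contradiction with the non-triviality of the limit
  have hQ : parabolicCylinder (1 / 2) (0 : ℝ × EuclideanSpace ℝ (Fin 3)) =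
      Ioo (-(1 / 4 : ℝ)) 0 ×ˢ ball (0 : EuclideanSpace ℝ (Fin 3)) (1 / 2) := by
    rw [parabolicCylinder]
    simp only [Prod.fst_zero, Prod.snd_zero, zero_sub]
    norm_num
  have hzero : ∫⁻ z in parabolicCylinder (1 / 2) (0 : ℝ × EuclideanSpace ℝ (Fin 3)),
      ‖w z.1 z.2‖ₑ ^ (3 : ℕ) = 0 := by
    have hf : AEMeasurable (fun z : ℝ × EuclideanSpace ℝ (Fin 3) => ‖w z.1 z.2‖ₑ ^ (3 : ℕ))
        ((volume.restrict (Ioo (-(1 / 4 : ℝ)) 0)).prod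
          (volume.restrict (ball (0 : EuclideanSpace ℝ (Fin 3)) (1 / 2)))) := by
      rw [Measure.prod_restrict, ← Measure.volume_eq_prod, ← hQ]
      exact ((hwm _ (by norm_num)).aestronglyMeasurable.enorm.pow_const 3)
    rw [hQ, Measure.volume_eq_prod, ← Measure.prod_restrict, lintegral_prod _ hf]
    refine (lintegral_congr_ae ?_).trans lintegral_zero
    filter_upwards [hae0] with t ht
    refine (lintegral_congr_ae ?_).trans lintegral_zero
    filter_upwards [ae_restrict_of_ae ht] with x hx
    simp [hx]
  rw [hzero, nonpos_iff_eq_zero, ENNReal.ofReal_eq_zero] at hlow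
  nlinarith

/-- **ESS 2003, Thm. 1.4, from the quantitative higher regularity of bounded weak solutions.**
`ess_local_holder` (the local Hölder continuity of `L_{3,∞}`-solutions, ESS Thm. 1.4) follows
from the single named fact `NSBoundedHigherRegularityBounds` (Serrin 1962; ESS §3
(3.26)–(3.30): "all derivatives of a bounded weak solution are bounded in the interior"), by
the covering reduction `ess_local_holder_of_epsilonRegularity_of_noConcentration`, the proved
ε-regularity `ess_epsilon_regularity'_holds` (ESS Lemma 2.2) and
`noConcentration_of_higherRegularityBounds`. [cite: EscauriazaSereginSverak2003, Thm. 1.4 and §3] -/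
theorem ess_local_holder_of_higherRegularityBounds (hB : NSBoundedHigherRegularityBounds) :
    ess_local_holder :=
  ess_local_holder_of_epsilonRegularity_of_noConcentration ess_epsilon_regularity'_holds
    (noConcentration_of_higherRegularityBounds hB)

end Assembly

end Literature.Analysis.FluidPDE
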